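import Mathlib.LinearAlgebra.BilinearForm.Orthogonal
import Literature.Geometry.Riemannian.ChangGurskyYang
import Literature.Geometry.Riemannian.RicciFlowScalarCurvatureProofs
import Literature.Geometry.Riemannian.ConstantCurvature
import Literature.Geometry.Riemannian.RoundSphereProofs
import Literature.Geometry.Riemannian.MetricTraceScaling
import Literature.Geometry.Riemannian.OrthonormalFrameBounds
import Literature.Geometry.Riemannian.YamabeConstant
import Literature.Geometry.Riemannian.YamabePositivity
import Literature.Geometry.Lorentzian.VolumeProofs
import Literature.Geometry.Lorentzian.LeviCivitaCurvature
import Literature.Topology.FourManifolds.RealProjectiveSpace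
import HarnessLib

/-!
# Chang–Gursky–Yang 2003, §0 and §2: the pointwise curvature algebra and the proof of Theorem A
# from Theorem 1.4 and Margerin's weak-pinching theorem

Companion ("Proofs") file of `Literature/Geometry/Riemannian/ChangGurskyYang.lean`, which vends
the named fact `Literature.Geometry.Riemannian.changGurskyYang_sphere_four` (Chang–Gursky–Yang
2003, Thm. A, in the simply connected `scal > 0` special case: a closed simply connected
`4`-manifold with a metric of positive scalar curvature and Weyl energy `∫|W|² dV < 32π²` is
diffeomorphic to `S⁴`). The theorem is deep (Chern–Gauss–Bonnet + the fully nonlinear conformal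
PDE of [CGY1], [CGY2] + Margerin's Ricci-flow pinching theorem) and is NOT discharged here. This
file formalizes, following the printed proof line by line, everything in it that is ALGEBRA, and
the final composition of §2 (p. 121), so that exactly the analytic inputs remain, as explicit
hypotheses of the reduction theorems
`changGurskyYang_sphere_four_of_margerin_of_pointwisePinching` (two bundled inputs) and
`changGurskyYang_sphere_four_of_margerin_of_yamabe_of_chernGaussBonnet_of_thm14` (item 14: the
four published inputs verbatim; item 15: three, `Y > 0` being proved):

1. **The `O(4)`-decomposition (0.1) in a frame.** With `E = Ric - ¼ R g` the trace-free Ricci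
   tensor (`tracelessRicciFrame`), the Kulkarni–Nomizu product `⊙` (`kulkarniNomizu`, written in
   the slot convention of this tree, Besse 1987, 1.110 with the last two slots exchanged, exactly
   as in `WeylEnergy.lean`) and the Weyl tensor `W` of `WeylEnergy.lean` (`weylFrame`), the
   identity `Riem = W + ½ E ⊙ g + (1/24) R g ⊙ g` (Chang–Gursky–Yang 2003, (0.1)) holds
   component-wise in every `4`-frame (`curvatureForm_eq_weylFrame_add`; it is the definition of
   `W` rearranged), and with `Z = W + ½ E ⊙ g` (`zFrame`) it reads `Riem = Z + (1/24) R g ⊙ g`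
   (`curvatureForm_eq_zFrame_add`; ibid. p. 106, first display).
2. **(0.2): `|Z|² = |W|² + 2|E|²`** (`(0,4)`-norms, ibid. (0.2) and Remark 2) in every
   orthonormal basis of `T_x M` for a `C²` metric with its Levi-Civita connection
   (`zNormSqFrame_eq`): the cross term `Σ W_{ijkl} (E ⊙ δ)_{ijkl}` vanishes because `W` is totally
   trace-free (`sum_weylFrame_mul_kulkarniNomizu_eq_zero`, from `sum_weylFrame_eq_zero` of
   `WeylEnergy.lean` and the antisymmetries of `W`, the second of which, `W_{ijkl} = -W_{ijlk}`,
   is O'Neill 1983, Prop. 3.36 (2) for `Rm`, `weylFrame_antisymm₃₄`), and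
   `|E ⊙ δ|² = 8|E|² + 4 (tr E)² = 8|E|²` in dimension `4` (`sum_kulkarniNomizu_frameDelta_sq`,
   `sum_tracelessRicciFrame_diag`).
3. **`σ₂(A) = -½|E|² + R²/24`** for the Weyl–Schouten tensor `A = Ric - (1/6) R g` of §1
   (`weylSchoutenFrame`, `sigma2WeylSchoutenFrame`, `sigma2WeylSchoutenFrame_eq`; ibid. p. 110
   and p. 121: "rewriting `σ₂(A)` in terms of the trace-free Ricci tensor … and the scalar
   curvature"), so that the Chern–Gauss–Bonnet integrand of (0.4)/(1.1) is `¼|W|² + σ₂(A)` and the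
   integrand of (0.5)/(1.2) is `σ₂(A) - ¼|W|²`.
4. **"Rearranging terms"** (ibid. p. 108 and p. 121): pointwise `σ₂(A) - ¼|W|² > 0` gives
   `|W|² + 2|E|² < R²/6`, in particular `R ≠ 0`, i.e. Margerin's weak pinching
   `WP = (|W|² + 2|E|²)/R² < 1/6` (`weakPinching_of_sigma2_sub_pos`,
   `weylNormSqFrame_add_lt_of_sigma2_sub_pos`).
5. **§2, the proof of Theorem A (p. 121), as a reduction.** Given
   (a) MARGERIN'S THEOREM (Margerin 1998, Thm. 1 with Part I, p. 25 and Prop. 4: a compact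
   `4`-manifold with a metric of positive scalar curvature whose weak pinching
   `|W + ½ z ⊙ g|²/scal²` is `< 1/6` pointwise is diffeomorphic to `S⁴` if orientable, else to the
   standard `ℝP⁴`; quoted in Chang–Gursky–Yang 2003, p. 106, with `WP` as in (0.2)) and
   (b) THE POINTWISE-PINCHING EXISTENCE STATEMENT delivered by §1 under the hypotheses of the
   vended special case (Thm. 1.4 with `α = 1`, applied after (0.3) ⇔ (1.2), i.e. after
   Chern–Gauss–Bonnet (1.1) and `χ(M) ≥ 2` for simply connected closed `M`: there is a — conformal,
   not needed here — metric with `σ₂(A) - ¼|W|² > 0` pointwise and positive scalar curvature),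
   the fact `changGurskyYang_sphere_four` follows
   (`changGurskyYang_sphere_four_of_margerin_of_pointwisePinching`): items 3–4 turn (b) into weak
   pinching `< 1/6` in every orthonormal frame, (a) gives `S⁴` or `ℝP⁴`, and `π₁(ℝP⁴) = ℤ₂ ≠ 1`
   (`IsRealProjectiveSpace.not_simplyConnectedSpace`) excludes `ℝP⁴` for simply connected `M` —
   verbatim the last paragraph of §2. Both (a) and (b) are deep analytic theorems absent from the
   tree (no Ricci-flow convergence theorem, no `σ₂`-Yamabe theory, no Chern–Gauss–Bonnet, no
   Yamabe invariant, no Euler characteristic of a manifold); they are hypotheses of the reduction,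
   not named facts (D-0026), and discharging them discharges `changGurskyYang_sphere_four`.

6. **Frame independence of `|W|²`** (the "elementary linear algebra" deferred in
   `WeylEnergy.lean`, needed to read the hypothesis `∫|W|² dV < 32π²` of the fact in frames): the
   frame Weyl tensor is the `4`-linear Weyl tensor `𝒲` (`weylTensor`, Besse 1987, (1.116)) evaluated
   on the frame (`weylFrame_eq_weylTensor`); `Σᵢ α(bᵢ)² = α(♯α)` for a linear functional and an
   orthonormal basis (`sum_sq_apply_of_isOrthonormalFrame`, Parseval), hence slot by slot
   `Σ T(bᵢ,bⱼ,b_k,b_l)²` is the same on all orthonormal bases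
   (`sum_sq_fourLinear_eq_of_isOrthonormalFrame`), so `weylNormSqFrame` is frame independent
   (`weylNormSqFrame_eq_of_isOrthonormalFrame`) and the supremum defining `weylNormSq` is attained
   by every orthonormal frame: `weylNormSq x = weylNormSqFrame x e`
   (`weylNormSq_eq_weylNormSqFrame`, and `weylNormSq_eq_weylNormSqFrame_four` for `Fin 4`-frames on
   a `4`-dimensional model).

7. **Constant sectional curvature has `W = 0` and zero Weyl energy** (Besse 1987, 1.118–1.119):
   in an orthonormal basis of a constant-curvature pair `Ric = (m-1)c δ`, `S = m(m-1)c`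
   (`HasConstantSectionalCurvatureWith.ricci_frame_eq`, `.scalarCurvature_eq_of_basis`), so the
   Weyl components vanish for `m ≥ 3` (`.weylFrame_eq_zero`), `|W|² ≡ 0` (`.weylNormSq_eq_zero`)
   and `∫|W|² dV = 0` (`.weylEnergy_eq_zero`).
8. **The round sphere** (Lee 2018, Thm. 8.34 (b), Prop. 8.36, on the proved Gauss-equation
   computation `curvature_roundMetric` of `RoundSphereProofs.lean`): constant sectional curvature
   `1` (`hasConstantSectionalCurvatureWith_roundMetric`), scalar curvature `m(m-1) > 0`
   (`scalarCurvature_roundMetric`, `scalarCurvature_roundMetric_pos`) and zero Weyl energy for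
   `m ≥ 3` (`weylEnergy_roundMetric_eq_zero`) — the model case `∫|W|² = 0 < 32π²`, `scal = 12 > 0`
   of the hypotheses of `changGurskyYang_sphere_four` on `S⁴`
   (`roundSphere_four_changGurskyYang_hypotheses`: the antecedent of the fact holds for the round
   `S⁴`, a non-vacuity certificate for the vended statement).

9. **`|Rm|² = |W|² + 2|E|² + S²/6` and `|W|² = |Rm|² - 2|Ric|² + S²/3` in dimension `4`**
   (Besse 1987, Thm. 1.114, 1.116–1.117; deferred in `WeylEnergy.lean`): the Pythagorean form of
   (0.1) — `W ⟂ h ⊙ δ` for every `h` (`sum_weylFrame_mul_kulkarniNomizu_frameDelta_eq_zero`),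
   `⟨h ⊙ δ, δ ⊙ δ⟩ = 24 tr h`, `|δ ⊙ δ|² = 96`, `|Ric|² = |E|² + S²/4` — as
   `curvNormSqFrame_eq`, `weylNormSqFrame_eq_curvNormSqFrame` (frame norms `curvNormSqFrame`,
   `ricciNormSqFrame`).

10. **Constant rescaling `g ↦ c g`** (Topping 2006, §1.2.3; the "scale-invariant" of
   Chang–Gursky–Yang 2003, p. 106): the Koszul functional is homogeneous in `g`
   (`koszulFunctional_constSmul`), so the bundled Levi-Civita connection of `LeviCivita.lean` is
   unchanged (`leviCivitaFun_constSmul`, `HasLeviCivita.constSmul`, `leviCivita_constSmul`), whence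
   `Ric(c g) = Ric(g)`, `S(c g) = c⁻¹ S(g)`, `Rm_{c g} = c Rm_g` (`ricci_constSmul`,
   `scalarCurvature_constSmul`, `curvatureForm_leviCivita_constSmul`), `W_{c g}(e) = c⁻¹ W_g(√c e)`
   (`weylFrame_constSmul`) and `|W_{c g}|² = c⁻² |W_g|²` pointwise (`weylNormSq_constSmul`) — the
   pointwise half of the scale invariance of `∫|W|² dV` in dimension `4`.

11. **(0.2) as printed — `|E|²(x)` and the weak pinching `WP(x)` as functions on `M`**: the
   trace-free Ricci tensor as a bilinear form (`tracelessRicci`), frame independence of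
   `Σ E_{ab}²` (`sum_sq_bilinForm_eq_of_isOrthonormalFrame`,
   `tracelessRicciNormSqFrame_eq_of_isOrthonormalFrame`), the pointwise norm `tracelessRicciNormSq`
   (supremum over orthonormal frames, `= frame value`, `tracelessRicciNormSq_eq_tracelessRicciNormSqFrame(_four)`),
   Margerin's `WP = (|W|² + 2|E|²)/S²` (`weakPinching`, `weakPinching_eq_of_isOrthonormalFrame`),
   `WP < 1/6 ↔` the frame condition of `hMargerin` where `S ≠ 0` (`weakPinching_lt_iff`), its
   scale invariance `WP_{c g} = WP_g` (`weakPinching_constSmul`, via `tracelessRicciNormSq_constSmul`)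
   and `E = 0`, `Z = 0`, `|E|² = 0`, `WP = 0` for constant sectional curvature
   (`HasConstantSectionalCurvatureWith.tracelessRicciFrame_eq_zero`, `.zFrame_eq_zero`,
   `.tracelessRicciNormSq_eq_zero`, `.weakPinching_eq_zero`; Chang–Gursky–Yang 2003, p. 106:
   constant curvature has `Z ≡ 0`).

12. **Finiteness of the Weyl energy on closed manifolds** (deferred in `WeylEnergy.lean`): `|W|²`
   is a fixed continuous function `weylNormSqPoly` of the curvature components of any orthonormal
   basis (`weylNormSqFrame_eq_weylNormSqPoly`), hence uniformly bounded on a compact manifold by the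
   orthonormal-frame compactness lemma `exists_pos_le_curvatureFunctional` of
   `OrthonormalFrameBounds.lean` applied to `1/(1 + |weylNormSqPoly|)` (`exists_weylNormSq_le`),
   and the Riemannian volume of a compact manifold is finite
   (`riemannianVolume_lt_top_of_isCompact_holds`), so `weylEnergy < ⊤` (`weylEnergy_lt_top`) — the
   hypothesis `∫|W|² dV < 32π²` of the fact is a condition on a real number.

13. **`σ₂(A)` and `∫σ₂(A) dV` as printed, and "this implies in particular that `R > 0`" (p. 108).**
   The pointwise function `σ₂(A_g)(x)` (`sigma2WeylSchouten`, supremum over orthonormal frames of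
   `½((tr A)² - tr A²)`, `= frame value` in dimension `4`, `sigma2WeylSchouten_eq_sigma2WeylSchoutenFrame`,
   `= -½|E|²(x) + S(x)²/24`, `sigma2WeylSchouten_eq`), the real number `∫_M σ₂(A_g) dV_g`
   (`sigma2WeylSchoutenIntegral`, built on the same measure as `weylEnergy`), pointwise
   `¼|W|² < σ₂(A)` ⇒ `WP < 1/6` and `R ≠ 0` (`weakPinching_lt_of_sigma2WeylSchouten_gt`,
   `scalarCurvature_ne_zero_of_sigma2WeylSchouten_gt`), and the sign argument behind "in particular
   `R > 0`": `Y(M,[g]) > 0` forces `∫R_g dV_g > 0` (`integral_scalarCurvature_pos_of_yamabeConstant_pos`,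
   on the Yamabe constant `yamabeConstant` of `YamabeConstant.lean`), so a nowhere-vanishing scalar
   curvature of a `C^∞` metric on a connected manifold is positive
   (`scalarCurvature_pos_of_yamabeConstant_pos`: continuity of `R`, intermediate value theorem).

14. **§2 verbatim** (`changGurskyYang_sphere_four_of_margerin_of_yamabe_of_chernGaussBonnet_of_thm14`):
   the fact `changGurskyYang_sphere_four` from FOUR hypotheses, each one published theorem stated in
   the tree's vocabulary — Margerin 1998, Thm. 1 (`R > 0`, `WP < 1/6` ⇒ `S⁴` or `ℝP⁴`, with the
   function `weakPinching`); `scal_g > 0 ⇒ Y(M,[g]) > 0` (Aubin 1982, §6.5; Lee–Parker 1987, (1.5));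
   Chern–Gauss–Bonnet (1.1) with `χ(M) ∈ ℕ`, `χ(M) ≥ 2` for closed simply connected `M` (Hatcher
   2002, Thm. 3.30); and Thm. 1.4 (`α = 1`) as printed (`Y > 0` and
   `∫σ₂(A) dV > ¼∫|W|² dV` ⇒ a CONFORMAL metric with `σ₂(A) - ¼|W|² > 0` pointwise) — the proof being
   the six lines of §2 plus p. 108, with `R > 0` for the conformal metric DERIVED (item 13) rather
   than assumed. This refines item 5, whose `hPointwise` bundled the last three inputs.

15. **`hYamabe` discharged** (`changGurskyYang_sphere_four_of_margerin_of_chernGaussBonnet_of_thm14`):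
   with `Y(M,[g]) > 0` for `scal_g > 0` now a theorem of the tree
   (`yamabeConstant_pos_of_scalarCurvature_pos`, `YamabePositivity.lean`: Aubin 1982, §6.5 via the
   conformal laws of `Lorentzian/ConformalChangeFour.lean`, Green's identity and the Sobolev
   inequality `SobolevClosedManifold.lean`), the fact follows from THREE hypotheses — Margerin's
   theorem, Chern–Gauss–Bonnet with `χ ≥ 2`, and Thm. 1.4 — the exact remaining proof debt.

Orthonormal frames `e : Fin 4 → T_x M` of a Riemannian metric on a `4`-dimensional model space
are bases (`IsOrthonormalFrame.linearIndependent`, `IsOrthonormalFrame.toBasis`), which feeds the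
frame formulas `Ric(X,Y) = Σᵢ Rm(eᵢ,X,Y,eᵢ)`, `S = Σᵢ Ric(eᵢ,eᵢ)` of
`RicciFlowScalarCurvatureProofs.lean` (O'Neill 1983, Lemma 3.52, Def. 3.53) into the algebra.

## References

* S.-Y. A. Chang, M. J. Gursky, P. C. Yang, *A conformally invariant sphere theorem in four
  dimensions*, Publ. Math. IHÉS 98 (2003) 105–143: (0.1), (0.2), Thm. A, Thm. A′, (0.4)–(0.5)
  (pp. 105–108), §1 (A = Ric - R g/6, (1.1)–(1.2), Thm. 1.4, pp. 110–113), §2 (p. 121).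
  [ChangGurskyYang2003]
* C. Margerin, *A sharp characterization of the smooth 4-sphere in curvature terms*, Comm. Anal.
  Geom. 6 (1998) 21–65: Thm. 1 (p. 21), Part I (p. 25: deviation `𝒟 = z ⊙ g/2 + W`, weak
  pinching `|𝒟|² scal⁻²`), Prop. 4 (p. 27). [Margerin1998]
* A. L. Besse, *Einstein Manifolds* (1987), 1.110, 1.116–1.117. [Besse1987]
* B. O'Neill, *Semi-Riemannian geometry* (1983), Ch. 2, Lemmas 24–25; Ch. 3, Prop. 3.36,
  Lemma 3.52, Def. 3.53, p. 60. [ONeill1983]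
* J. M. Lee, *Introduction to Riemannian Manifolds*, 2nd ed. (2018), Thm. 8.34 (b), Prop. 8.36.
  [Lee2018]
* P. Topping, *Lectures on the Ricci flow*, LMS LNS 325 (2006), §1.2.3, (1.2.8) (rescaling).
  [Topping2006]
* T. Aubin, *Nonlinear Analysis on Manifolds. Monge–Ampère Equations*, Grundlehren 252 (1982),
  Ch. 6, §6.3 eq. (1), §6.4 and Prop. 6.4, §6.5 (proof of the Theorem, (α): `R' > 0 ⇒ μ' > 0`).
  [Aubin1982]
* J. M. Lee, T. H. Parker, *The Yamabe problem*, Bull. AMS 17 (1987), §1, (1.5). [LeeParker1987]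
* A. Hatcher, *Algebraic Topology* (2002), Thm. 3.30 (Poincaré duality; `χ = 2 + b₂` for closed
  simply connected `4`-manifolds). [Hatcher2002]
-/

noncomputable section

open Bundle Finset Module
open scoped Manifold ContDiff Topology ENNReal

namespace Literature.Geometry.Riemannian

/-! ### Frame algebra: Kronecker delta and the Kulkarni–Nomizu product -/

section FrameAlgebra

variable {ι : Type*}

/-- The Kronecker symbol `δ_{ab}` as a real frame `2`-tensor (the components of the metric in an
orthonormal frame). [folklore] -/
def frameDelta [DecidableEq ι] (a b : ι) : ℝ := if a = b then 1 else 0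

/-- `δ_{aa} = 1`. [folklore] -/
@[simp] theorem frameDelta_self [DecidableEq ι] (a : ι) : frameDelta a a = 1 := by
  simp [frameDelta]

/-- `δ_{ab} = 0` for `a ≠ b`. [folklore] -/
theorem frameDelta_of_ne [DecidableEq ι] {a b : ι} (h : a ≠ b) : frameDelta a b = 0 := by
  simp [frameDelta, h]

/-- `δ` is symmetric. [folklore] -/
theorem frameDelta_comm [DecidableEq ι] (a b : ι) : frameDelta a b = frameDelta b a := by
  unfold frameDelta
  split_ifs with h₁ h₂ h₂
  · rfl
  · exact absurd h₁.symm h₂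
  · exact absurd h₂.symm h₁
  · rfl

/-- **The Kulkarni–Nomizu product of two frame `2`-tensors**, in the slot convention of this tree
(`Rm(X,Y,Z,W) = g(R(X,Y)Z,W)`, `K(X,Y) = Rm(X,Y,Y,X)`; Besse 1987, 1.110 with the last two slots
exchanged, as in `weylFrame` of `WeylEnergy.lean`):
`(h ⊙ k)_{abcd} = h_{ad} k_{bc} + h_{bc} k_{ad} - h_{ac} k_{bd} - h_{bd} k_{ac}`. This is the `∧`-product
of Chang–Gursky–Yang 2003, (0.1), in these conventions. [cite: Besse1987, 1.110]
[cite: ChangGurskyYang2003, (0.1)] -/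
def kulkarniNomizu (h k : ι → ι → ℝ) (a b c d : ι) : ℝ :=
  h a d * k b c + h b c * k a d - h a c * k b d - h b d * k a c

/-- Unfolding of `kulkarniNomizu`. [cite: Besse1987, 1.110] -/
theorem kulkarniNomizu_apply (h k : ι → ι → ℝ) (a b c d : ι) :
    kulkarniNomizu h k a b c d = h a d * k b c + h b c * k a d - h a c * k b d - h b d * k a c :=
  rfl

/-- `h ⊙ k` is antisymmetric in its first two slots. [cite: Besse1987, 1.110] -/
theorem kulkarniNomizu_antisymm₁₂ (h k : ι → ι → ℝ) (a b c d : ι) :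
    kulkarniNomizu h k a b c d = - kulkarniNomizu h k b a c d := by
  simp only [kulkarniNomizu]
  ring

/-- `h ⊙ k` is antisymmetric in its last two slots. [cite: Besse1987, 1.110] -/
theorem kulkarniNomizu_antisymm₃₄ (h k : ι → ι → ℝ) (a b c d : ι) :
    kulkarniNomizu h k a b c d = - kulkarniNomizu h k a b d c := by
  simp only [kulkarniNomizu]
  ring

set_option maxRecDepth 20000 in
/-- **`|h ⊙ δ|² = 8|h|² + 4 (tr h)²` in dimension `4`** (the general formula is
`4(m-2)|h|² + 4(tr h)²`): the squared frame norm of the Kulkarni–Nomizu product of a frame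
`2`-tensor with the Kronecker symbol. For trace-free `h = E` this is the identity
`|E ⊙ g|² = 8|E|²` behind (0.2) of Chang–Gursky–Yang 2003 (`|½ E ⊙ g|² = 2|E|²`). Proved by
expanding the `4⁴` components. [cite: ChangGurskyYang2003, (0.2)] -/
theorem sum_kulkarniNomizu_frameDelta_sq (h : Fin 4 → Fin 4 → ℝ) :
    ∑ i, ∑ j, ∑ k, ∑ l, kulkarniNomizu h frameDelta i j k l ^ 2 =
      8 * ∑ a, ∑ b, h a b ^ 2 + 4 * (∑ a, h a a) ^ 2 := by
  simp only [Fin.sum_univ_four, kulkarniNomizu, frameDelta, Fin.isValue, Fin.reduceEq, if_true,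
    if_false, mul_one, mul_zero, add_zero, zero_add, sub_zero, zero_sub]
  ring

set_option maxRecDepth 20000 in
/-- **Regrouping of the cross term** `Σ_{ijkl} W_{ijkl} (h ⊙ δ)_{ijkl}` of a frame `4`-tensor `W`
against `h ⊙ δ` into the four contractions `Σ_j W_{ijjl}`, `Σ_i W_{ijki}`, `Σ_j W_{ijkj}`,
`Σ_i W_{ijil}` of `W` paired with `h` (dimension `4`; pure bookkeeping, by expanding the `4⁴`
components). For a totally trace-free `W` all four vanish. [folklore] -/
theorem sum_mul_kulkarniNomizu_frameDelta (W : Fin 4 → Fin 4 → Fin 4 → Fin 4 → ℝ)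
    (h : Fin 4 → Fin 4 → ℝ) :
    ∑ i, ∑ j, ∑ k, ∑ l, W i j k l * kulkarniNomizu h frameDelta i j k l =
      ∑ i, ∑ l, (∑ j, W i j j l) * h i l + ∑ j, ∑ k, (∑ i, W i j k i) * h j k -
        ∑ i, ∑ k, (∑ j, W i j k j) * h i k - ∑ j, ∑ l, (∑ i, W i j i l) * h j l := by
  simp only [Fin.sum_univ_four, kulkarniNomizu, frameDelta, Fin.isValue, Fin.reduceEq, if_true,
    if_false, mul_one, mul_zero, add_zero, zero_add, sub_zero, zero_sub]
  ring

set_option maxRecDepth 20000 in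
/-- **`⟨h ⊙ δ, δ ⊙ δ⟩ = 24 tr h` in dimension `4`** (frame inner product of Kulkarni–Nomizu
products): for trace-free `h = E` the parts `E ⊙ g` and `g ⊙ g` of the `O(4)`-decomposition are
orthogonal, and for `h = δ`, `|δ ⊙ δ|² = 96`. Proved by expanding the `4⁴` components. [folklore] -/
theorem sum_kulkarniNomizu_frameDelta_mul_kulkarniNomizu_frameDelta (h : Fin 4 → Fin 4 → ℝ) :
    ∑ i, ∑ j, ∑ k, ∑ l, kulkarniNomizu h frameDelta i j k l *
      kulkarniNomizu (frameDelta (ι := Fin 4)) frameDelta i j k l = 24 * ∑ a, h a a := by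
  simp only [Fin.sum_univ_four, kulkarniNomizu, frameDelta, Fin.isValue, Fin.reduceEq, if_true,
    if_false, mul_one, mul_zero, add_zero, zero_add, sub_zero, zero_sub]
  ring

/-- `|δ ⊙ δ|² = 96` in dimension `4`. [folklore] -/
theorem sum_kulkarniNomizu_frameDelta_frameDelta_sq :
    ∑ i : Fin 4, ∑ j, ∑ k, ∑ l, kulkarniNomizu (frameDelta (ι := Fin 4)) frameDelta i j k l ^ 2 = 96 := by
  rw [sum_kulkarniNomizu_frameDelta_sq]
  simp only [frameDelta, Fin.sum_univ_four, Fin.isValue, Fin.reduceEq, if_true, if_false]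
  norm_num

/-- **"Rearranging terms"** (Chang–Gursky–Yang 2003, p. 108 and p. 121): if
`σ₂(A) = -½|E|² + R²/24` and `σ₂(A) - ¼|W|² > 0`, then `|W|² + 2|E|² < R²/6`. [cite: ChangGurskyYang2003, §2, p. 121] -/
theorem weakPinching_of_sigma2_sub_pos {W₂ E₂ R σ : ℝ} (hσ : σ = -(1 / 2) * E₂ + R ^ 2 / 24)
    (h : 1 / 4 * W₂ < σ) : W₂ + 2 * E₂ < R ^ 2 / 6 := by
  subst hσ
  linarith

/-- … "Note that this implies in particular that" `R ≠ 0` (ibid. p. 108; the paper writes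
`R > 0`, which for the conformal metric of §1 holds by construction): `|W|², |E|² ≥ 0`.
[cite: ChangGurskyYang2003, §0, p. 108] -/
theorem scal_ne_zero_of_weakPinching {W₂ E₂ R : ℝ} (hW : 0 ≤ W₂) (hE : 0 ≤ E₂)
    (h : W₂ + 2 * E₂ < R ^ 2 / 6) : R ≠ 0 := by
  rintro rfl
  nlinarith

/-- "Dividing by `R²`, we conclude that `WP = (|W|² + 2|E|²)/R² < 1/6`" (ibid. p. 108).
[cite: ChangGurskyYang2003, §0, p. 108] -/
theorem weakPinching_div_lt {W₂ E₂ R : ℝ} (hR : R ≠ 0) (h : W₂ + 2 * E₂ < R ^ 2 / 6) :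
    (W₂ + 2 * E₂) / R ^ 2 < 1 / 6 := by
  have hR2 : 0 < R ^ 2 := by positivity
  rw [div_lt_iff₀ hR2]
  linarith

end FrameAlgebra

/-! ### The curvature algebra of a metric in a frame -/

section PseudoRiemannianMetric
open Literature.Geometry.Lorentzian (PseudoRiemannianMetric)
open Literature.Geometry.Lorentzian.PseudoRiemannianMetric

variable {E : Type*} [NormedAddCommGroup E] [NormedSpace ℝ E] {H : Type*} [TopologicalSpace H]
  {I : ModelWithCorners ℝ E H} {M : Type*} [TopologicalSpace M] [ChartedSpace H M]
  [IsManifold I ∞ M] {n : ℕ∞ω}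

/-! #### Orthonormal frames are bases -/

section Frames

variable (g : PseudoRiemannianMetric I n E (TangentSpace I : M → Type _)) {x : M}

variable {g} in
/-- An orthonormal frame (for any pseudo-Riemannian metric: `g(eᵢ,eᵢ) = 1`, `g(eᵢ,eⱼ) = 0`) is
linearly independent: pair a vanishing linear combination with `e_i`. O'Neill 1983, Ch. 2,
Lemma 24 ff. [cite: ONeill1983, Ch. 2, Lemma 24 (p. 50)] -/
theorem _root_.Literature.Geometry.Lorentzian.PseudoRiemannianMetric.IsOrthonormalFrame.linearIndependent
    {ι : Type*} {e : ι → TangentSpace I x} (he : g.IsOrthonormalFrame x e) :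
    LinearIndependent ℝ e :=
  LinearMap.BilinForm.linearIndependent_of_iIsOrtho (B := g.toBilinForm x)
    (LinearMap.BilinForm.iIsOrtho_def.2 fun i j hij ↦ by simpa using he.2 i j hij)
    fun i ↦ by simp [he.1 i]

variable {g} in
/-- An orthonormal frame indexed by a type of cardinality `dim E` is a basis of `T_x M`
(`basisOfLinearIndependentOfCardEqFinrank`). [cite: ONeill1983, Ch. 2, Lemma 24 (p. 50)] -/
def _root_.Literature.Geometry.Lorentzian.PseudoRiemannianMetric.IsOrthonormalFrame.toBasis
    [FiniteDimensional ℝ E] {ι : Type*} [Fintype ι] {e : ι → TangentSpace I x}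
    (he : g.IsOrthonormalFrame x e) (hι : Fintype.card ι = finrank ℝ E) :
    Basis ι ℝ (TangentSpace I x) :=
  haveI : FiniteDimensional ℝ (TangentSpace I x) := ‹FiniteDimensional ℝ E›
  Basis.mk he.linearIndependent
    (he.linearIndependent.span_eq_top_of_card_eq_finrank' (hι.trans rfl)).ge

variable {g} in
/-- The basis of an orthonormal frame is the frame. [folklore] -/
@[simp] theorem _root_.Literature.Geometry.Lorentzian.PseudoRiemannianMetric.IsOrthonormalFrame.coe_toBasis
    [FiniteDimensional ℝ E] {ι : Type*} [Fintype ι] {e : ι → TangentSpace I x}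
    (he : g.IsOrthonormalFrame x e) (hι : Fintype.card ι = finrank ℝ E) :
    ⇑(he.toBasis hι) = e :=
  Basis.coe_mk _ _

end Frames

variable (g : PseudoRiemannianMetric I n E (TangentSpace I : M → Type _))
variable [FiniteDimensional ℝ E] [g.HasLeviCivita]

/-! #### Trace-free Ricci tensor, `Z = W + ½ E ⊙ g`, the Weyl–Schouten tensor and `σ₂` -/

/-- **The trace-free Ricci tensor in a frame**, `E_{ab} = Ric(e_a, e_b) - (S/m) δ_{ab}`
(`m = |ι|`; in dimension `4`, `E = Ric - ¼ R g`, Chang–Gursky–Yang 2003, (0.1); Margerin's `z`).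
Meaningful for a `g_x`-orthonormal frame. [cite: ChangGurskyYang2003, (0.1)] -/
def _root_.Literature.Geometry.Lorentzian.PseudoRiemannianMetric.tracelessRicciFrame (x : M)
    {ι : Type*} [Fintype ι] [DecidableEq ι] (e : ι → TangentSpace I x) (a b : ι) : ℝ :=
  g.ricci x (e a) (e b) - g.scalarCurvature x / Fintype.card ι * frameDelta a b

/-- Unfolding of `tracelessRicciFrame`. [cite: ChangGurskyYang2003, (0.1)] -/
theorem _root_.Literature.Geometry.Lorentzian.PseudoRiemannianMetric.tracelessRicciFrame_apply (x : M)
    {ι : Type*} [Fintype ι] [DecidableEq ι] (e : ι → TangentSpace I x) (a b : ι) :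
    g.tracelessRicciFrame x e a b =
      g.ricci x (e a) (e b) - g.scalarCurvature x / Fintype.card ι * frameDelta a b :=
  rfl

/-- **`|E|² = Σ_{ab} E_{ab}²`**, the frame expression of the squared `(0,2)`-norm of the
trace-free Ricci tensor (Chang–Gursky–Yang 2003, (0.2)). [cite: ChangGurskyYang2003, (0.2)] -/
def _root_.Literature.Geometry.Lorentzian.PseudoRiemannianMetric.tracelessRicciNormSqFrame (x : M)
    {ι : Type*} [Fintype ι] [DecidableEq ι] (e : ι → TangentSpace I x) : ℝ :=
  ∑ a, ∑ b, g.tracelessRicciFrame x e a b ^ 2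

/-- `|E|² ≥ 0`. [folklore] -/
theorem _root_.Literature.Geometry.Lorentzian.PseudoRiemannianMetric.tracelessRicciNormSqFrame_nonneg
    (x : M) {ι : Type*} [Fintype ι] [DecidableEq ι] (e : ι → TangentSpace I x) :
    0 ≤ g.tracelessRicciNormSqFrame x e :=
  Finset.sum_nonneg fun _ _ ↦ Finset.sum_nonneg fun _ _ ↦ sq_nonneg _

/-- **`E` is trace-free** in any frame computing the scalar curvature (`Σᵢ Ric(eᵢ,eᵢ) = S`, as
every orthonormal basis does), provided the frame is nonempty. [cite: ChangGurskyYang2003, (0.1)] -/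
theorem _root_.Literature.Geometry.Lorentzian.PseudoRiemannianMetric.sum_tracelessRicciFrame_diag
    (x : M) {ι : Type*} [Fintype ι] [DecidableEq ι] [Nonempty ι] (e : ι → TangentSpace I x)
    (hS : ∑ i, g.ricci x (e i) (e i) = g.scalarCurvature x) :
    ∑ a, g.tracelessRicciFrame x e a a = 0 := by
  have hcard : (Fintype.card ι : ℝ) ≠ 0 := by exact_mod_cast Fintype.card_ne_zero
  simp only [tracelessRicciFrame, frameDelta_self, mul_one, Finset.sum_sub_distrib, hS,
    Finset.sum_const, Finset.card_univ, nsmul_eq_mul]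
  field_simp
  ring

/-- **`Z = W + ½ E ⊙ g` in a `4`-frame** (Chang–Gursky–Yang 2003, p. 105: "If we let
`Z = W + ½ E ∧ g`, then `Riem = Z + (1/24) R g ∧ g`"; Margerin's deviation `𝒟 = z ⊙ g/2 + W`,
1998, p. 25), with `W` the frame Weyl tensor `weylFrame` of `WeylEnergy.lean`.
[cite: ChangGurskyYang2003, (0.1)–(0.2)] [cite: Margerin1998, Part I, p. 25] -/
def _root_.Literature.Geometry.Lorentzian.PseudoRiemannianMetric.zFrame (x : M)
    (e : Fin 4 → TangentSpace I x) (i j k l : Fin 4) : ℝ :=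
  g.weylFrame x e i j k l + 1 / 2 * kulkarniNomizu (g.tracelessRicciFrame x e) frameDelta i j k l

/-- **`|Z|² = Σ_{ijkl} Z_{ijkl}²`**, the frame expression of the `(0,4)`-norm of `Z`
(Chang–Gursky–Yang 2003, (0.2): "`|Z|² = Z_{ijkl} Z^{ijkl}` denotes the norm of `Z` viewed as a
`(0,4)`-tensor"). [cite: ChangGurskyYang2003, (0.2)] -/
def _root_.Literature.Geometry.Lorentzian.PseudoRiemannianMetric.zNormSqFrame (x : M)
    (e : Fin 4 → TangentSpace I x) : ℝ :=
  ∑ i, ∑ j, ∑ k, ∑ l, g.zFrame x e i j k l ^ 2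

/-- **The Weyl–Schouten tensor `A = Ric - (1/6) R g` in a frame** (Chang–Gursky–Yang 2003, §1,
p. 110; the four-dimensional normalisation, `A = 2P` with `P` the Schouten tensor), component
`A_{ab} = Ric(e_a,e_b) - (S/6) δ_{ab}`. [cite: ChangGurskyYang2003, §1, p. 110] -/
def _root_.Literature.Geometry.Lorentzian.PseudoRiemannianMetric.weylSchoutenFrame (x : M)
    {ι : Type*} [Fintype ι] [DecidableEq ι] (e : ι → TangentSpace I x) (a b : ι) : ℝ :=
  g.ricci x (e a) (e b) - g.scalarCurvature x / 6 * frameDelta a b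

/-- **`σ₂(A) = σ₂(g⁻¹A)`**, the second elementary symmetric function of the eigenvalues of the
Weyl–Schouten endomorphism (Chang–Gursky–Yang 2003, (1.0) and p. 111), computed in a frame as
`½((tr A)² - tr(A²)) = ½((Σ_a A_{aa})² - Σ_{ab} A_{ab} A_{ba})` (valid expression of `σ₂(g⁻¹A)` in
a `g_x`-orthonormal basis). [cite: ChangGurskyYang2003, §1, (1.0)–(1.1)] -/
def _root_.Literature.Geometry.Lorentzian.PseudoRiemannianMetric.sigma2WeylSchoutenFrame (x : M)
    {ι : Type*} [Fintype ι] [DecidableEq ι] (e : ι → TangentSpace I x) : ℝ :=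
  1 / 2 * ((∑ a, g.weylSchoutenFrame x e a a) ^ 2 -
    ∑ a, ∑ b, g.weylSchoutenFrame x e a b * g.weylSchoutenFrame x e b a)

/-! #### (0.1): `Riem = W + ½ E ⊙ g + (R/24) g ⊙ g` -/

/-- **Chang–Gursky–Yang 2003, (0.1)**: `Riem = W + ½ E ⊙ g + (1/24) R g ⊙ g`, component-wise in
any `4`-frame `e` (for the frame Weyl tensor of `WeylEnergy.lean` this is its defining formula
`weylFrame_fin_four` rearranged: `½ E ⊙ δ + (R/24) δ ⊙ δ = ½ Ric ⊙ δ - (R/6)(δ_{il}δ_{jk} - δ_{ik}δ_{jl})`).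
[cite: ChangGurskyYang2003, (0.1)] -/
theorem _root_.Literature.Geometry.Lorentzian.PseudoRiemannianMetric.curvatureForm_eq_weylFrame_add
    (x : M) (e : Fin 4 → TangentSpace I x) (i j k l : Fin 4) :
    g.curvatureForm g.leviCivita x (e i) (e j) (e k) (e l) =
      g.weylFrame x e i j k l +
        1 / 2 * kulkarniNomizu (g.tracelessRicciFrame x e) frameDelta i j k l +
        g.scalarCurvature x / 24 * kulkarniNomizu (frameDelta (ι := Fin 4)) frameDelta i j k l := by
  rw [weylFrame_fin_four]
  simp only [kulkarniNomizu, tracelessRicciFrame, frameDelta, Fintype.card_fin]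
  push_cast
  ring

/-- **`Riem = Z + (1/24) R g ⊙ g`** (Chang–Gursky–Yang 2003, p. 106, first display), in any
`4`-frame. [cite: ChangGurskyYang2003, (0.1)] -/
theorem _root_.Literature.Geometry.Lorentzian.PseudoRiemannianMetric.curvatureForm_eq_zFrame_add
    (x : M) (e : Fin 4 → TangentSpace I x) (i j k l : Fin 4) :
    g.curvatureForm g.leviCivita x (e i) (e j) (e k) (e l) =
      g.zFrame x e i j k l +
        g.scalarCurvature x / 24 * kulkarniNomizu (frameDelta (ι := Fin 4)) frameDelta i j k l := by
  rw [curvatureForm_eq_weylFrame_add, zFrame]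

/-! #### Symmetries and traces of `W`; the cross term of (0.2) -/

section Symmetries

variable [Fact (1 ≤ n)] [CompleteSpace E]

/-- `Rm(X,Y,Z,W) = -Rm(X,Y,W,Z)` for the Levi-Civita connection of a `C²` metric (O'Neill 1983,
Prop. 3.36 (2); `val_riemann_skew` of `LeviCivitaProofs.lean`).
[cite: ONeill1983, Ch. 3, Prop. 3.36 (2), p. 75] -/
theorem _root_.Literature.Geometry.Lorentzian.PseudoRiemannianMetric.curvatureForm_leviCivita_antisymm₃₄
    (hn : 2 ≤ n) (x : M) (X Y Z W : TangentSpace I x) :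
    g.curvatureForm g.leviCivita x X Y Z W = - g.curvatureForm g.leviCivita x X Y W Z :=
  g.val_riemann_skew hn x X Y Z W

/-- **`W_{ijkl} = -W_{ijlk}`**: the frame Weyl tensor of a `C²` metric is antisymmetric in its last
two slots (from the same property of `Rm` and of the Ricci/scalar corrections).
[cite: Besse1987, (1.116)] -/
theorem _root_.Literature.Geometry.Lorentzian.PseudoRiemannianMetric.weylFrame_antisymm₃₄ (hn : 2 ≤ n)
    (x : M) {ι : Type*} [Fintype ι] [DecidableEq ι] (e : ι → TangentSpace I x) (i j k l : ι) :
    g.weylFrame x e i j k l = - g.weylFrame x e i j l k := by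
  rw [weylFrame_apply, weylFrame_apply,
    g.curvatureForm_leviCivita_antisymm₃₄ hn x (e i) (e j) (e k) (e l)]
  by_cases hjk : j = k <;> by_cases hil : i = l <;> by_cases hjl : j = l <;> by_cases hik : i = k <;>
    simp [hjk, hil, hjl, hik] <;> ring

/-- **`W` is orthogonal to every `h ⊙ δ`**: `Σ_{ijkl} W_{ijkl} (h ⊙ δ)_{ijkl} = 0` for any frame
`2`-tensor `h`, in a `4`-frame computing the Ricci contraction and the scalar curvature (every
orthonormal basis), for a `C²` metric: by `sum_mul_kulkarniNomizu_frameDelta` the sum is a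
combination of the four contractions of `W`, which vanish by total trace-freeness
(`sum_weylFrame_eq_zero`, Besse 1987, Thm. 1.114: `𝒲 = Ker c`, orthogonal to `g ⊙ S²`) and the
antisymmetries `weylFrame_antisymm`, `weylFrame_antisymm₃₄`. [cite: Besse1987, Thm. 1.114] -/
theorem _root_.Literature.Geometry.Lorentzian.PseudoRiemannianMetric.sum_weylFrame_mul_kulkarniNomizu_frameDelta_eq_zero
    (hn : 2 ≤ n) (x : M) (e : Fin 4 → TangentSpace I x)
    (hRic : ∀ a b, ∑ i, g.curvatureForm g.leviCivita x (e i) (e a) (e b) (e i) = g.ricci x (e a) (e b))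
    (hS : ∑ i, g.ricci x (e i) (e i) = g.scalarCurvature x) (h : Fin 4 → Fin 4 → ℝ) :
    ∑ i, ∑ j, ∑ k, ∑ l, g.weylFrame x e i j k l * kulkarniNomizu h frameDelta i j k l = 0 := by
  have C14 : ∀ j k, ∑ i, g.weylFrame x e i j k i = 0 := fun j k ↦
    g.sum_weylFrame_eq_zero x e (by simp) hRic hS j k
  have C13 : ∀ j l, ∑ i, g.weylFrame x e i j i l = 0 := fun j l ↦ by
    calc ∑ i, g.weylFrame x e i j i l = ∑ i, - g.weylFrame x e i j l i :=
          Finset.sum_congr rfl fun i _ ↦ g.weylFrame_antisymm₃₄ hn x e i j i l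
      _ = 0 := by rw [Finset.sum_neg_distrib, C14 j l, neg_zero]
  have C24 : ∀ i k, ∑ j, g.weylFrame x e i j k j = 0 := fun i k ↦ by
    calc ∑ j, g.weylFrame x e i j k j = ∑ j, - g.weylFrame x e j i k j :=
          Finset.sum_congr rfl fun j _ ↦ g.weylFrame_antisymm x e i j k j
      _ = 0 := by rw [Finset.sum_neg_distrib, C14 i k, neg_zero]
  have C23 : ∀ i l, ∑ j, g.weylFrame x e i j j l = 0 := fun i l ↦ by
    calc ∑ j, g.weylFrame x e i j j l = ∑ j, g.weylFrame x e j i l j :=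
          Finset.sum_congr rfl fun j _ ↦ by
            rw [g.weylFrame_antisymm x e i j j l, g.weylFrame_antisymm₃₄ hn x e j i j l, neg_neg]
      _ = 0 := C14 i l
  rw [sum_mul_kulkarniNomizu_frameDelta]
  simp [C14, C13, C24, C23]

/-- **The cross term of (0.2) vanishes**: `Σ_{ijkl} W_{ijkl} (E ⊙ δ)_{ijkl} = 0` in a `4`-frame
computing the Ricci contraction and the scalar curvature (every orthonormal basis), for a `C²`
metric: by `sum_mul_kulkarniNomizu_frameDelta` the sum is a combination of the four contractions
of `W`, which vanish by total trace-freeness (`sum_weylFrame_eq_zero`, Besse 1987, Thm. 1.114)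
and the antisymmetries `weylFrame_antisymm`, `weylFrame_antisymm₃₄`. This is the orthogonality of
the `W`- and `E ⊙ g`-parts of the `O(4)`-decomposition. [cite: ChangGurskyYang2003, (0.2)]
[cite: Besse1987, Thm. 1.114] -/
theorem _root_.Literature.Geometry.Lorentzian.PseudoRiemannianMetric.sum_weylFrame_mul_kulkarniNomizu_eq_zero
    (hn : 2 ≤ n) (x : M) (e : Fin 4 → TangentSpace I x)
    (hRic : ∀ a b, ∑ i, g.curvatureForm g.leviCivita x (e i) (e a) (e b) (e i) = g.ricci x (e a) (e b))
    (hS : ∑ i, g.ricci x (e i) (e i) = g.scalarCurvature x) :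
    ∑ i, ∑ j, ∑ k, ∑ l,
      g.weylFrame x e i j k l * kulkarniNomizu (g.tracelessRicciFrame x e) frameDelta i j k l = 0 :=
  g.sum_weylFrame_mul_kulkarniNomizu_frameDelta_eq_zero hn x e hRic hS _

/-! #### (0.2): `|Z|² = |W|² + 2|E|²` -/

/-- **Chang–Gursky–Yang 2003, (0.2): `|Z|² = |W|² + 2|E|²`** with `(0,4)`-norms, in a
`4`-frame computing the Ricci contraction and the scalar curvature, for a `C²` metric:
`Σ (W + ½ E⊙δ)² = Σ W² + Σ W (E⊙δ) + ¼ Σ (E⊙δ)²`, the cross term vanishes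
(`sum_weylFrame_mul_kulkarniNomizu_eq_zero`) and `Σ (E⊙δ)² = 8|E|² + 4(tr E)² = 8|E|²`
(`sum_kulkarniNomizu_frameDelta_sq`, `sum_tracelessRicciFrame_diag`). Here
`|W|² = weylNormSqFrame` of `WeylEnergy.lean`. [cite: ChangGurskyYang2003, (0.2)] -/
theorem _root_.Literature.Geometry.Lorentzian.PseudoRiemannianMetric.zNormSqFrame_eq_of_frame
    (hn : 2 ≤ n) (x : M) (e : Fin 4 → TangentSpace I x)
    (hRic : ∀ a b, ∑ i, g.curvatureForm g.leviCivita x (e i) (e a) (e b) (e i) = g.ricci x (e a) (e b))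
    (hS : ∑ i, g.ricci x (e i) (e i) = g.scalarCurvature x) :
    g.zNormSqFrame x e = g.weylNormSqFrame x e + 2 * g.tracelessRicciNormSqFrame x e := by
  have hsq : ∀ i j k l, g.zFrame x e i j k l ^ 2 =
      g.weylFrame x e i j k l ^ 2 +
        g.weylFrame x e i j k l * kulkarniNomizu (g.tracelessRicciFrame x e) frameDelta i j k l +
        1 / 4 * kulkarniNomizu (g.tracelessRicciFrame x e) frameDelta i j k l ^ 2 := by
    intro i j k l
    rw [zFrame]
    ring
  simp only [zNormSqFrame, weylNormSqFrame, tracelessRicciNormSqFrame, hsq, Finset.sum_add_distrib,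
    ← Finset.mul_sum]
  rw [g.sum_weylFrame_mul_kulkarniNomizu_eq_zero hn x e hRic hS, sum_kulkarniNomizu_frameDelta_sq,
    g.sum_tracelessRicciFrame_diag x e hS]
  ring

/-! #### `|W|² = |Rm|² - 2|Ric|² + S²/3` in dimension `4` -/

/-- **`|Rm|² = Σ_{ijkl} Rm(eᵢ,eⱼ,e_k,e_l)²`**, the frame expression of the squared `(0,4)`-norm of
the curvature tensor (for an orthonormal basis: `|Rm|²_g`, cf. `curvNormSqWith` of
`CurvatureNormSq.lean`, defined by traces). [folklore] -/
def _root_.Literature.Geometry.Lorentzian.PseudoRiemannianMetric.curvNormSqFrame (x : M)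
    {ι : Type*} [Fintype ι] (e : ι → TangentSpace I x) : ℝ :=
  ∑ i, ∑ j, ∑ k, ∑ l, g.curvatureForm g.leviCivita x (e i) (e j) (e k) (e l) ^ 2

/-- **`|Ric|² = Σ_{ab} Ric(e_a,e_b)²`**, the frame expression of the squared norm of the Ricci
tensor (for an orthonormal basis). [folklore] -/
def _root_.Literature.Geometry.Lorentzian.PseudoRiemannianMetric.ricciNormSqFrame (x : M)
    {ι : Type*} [Fintype ι] (e : ι → TangentSpace I x) : ℝ :=
  ∑ a, ∑ b, g.ricci x (e a) (e b) ^ 2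

omit [Fact (1 ≤ n)] [CompleteSpace E] in
/-- **`|Ric|² = |E|² + S²/4`** in a `4`-frame computing the scalar curvature
(`E = Ric - ¼ S δ`, `tr E = 0`). [cite: ChangGurskyYang2003, (0.1)] -/
theorem _root_.Literature.Geometry.Lorentzian.PseudoRiemannianMetric.ricciNormSqFrame_eq (x : M)
    (e : Fin 4 → TangentSpace I x) (hS : ∑ i, g.ricci x (e i) (e i) = g.scalarCurvature x) :
    g.ricciNormSqFrame x e = g.tracelessRicciNormSqFrame x e + g.scalarCurvature x ^ 2 / 4 := by
  simp only [ricciNormSqFrame, tracelessRicciNormSqFrame, tracelessRicciFrame, Fintype.card_fin,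
    Fin.sum_univ_four, frameDelta, Fin.isValue, Fin.reduceEq, if_true, if_false, mul_one, mul_zero,
    sub_zero] at hS ⊢
  push_cast
  linear_combination (g.scalarCurvature x / 2) * hS

/-- **`|Rm|² = |W|² + 2|E|² + S²/6` in dimension `4`** — the Pythagorean form of the
`O(4)`-decomposition (0.1) `Rm = W + ½ E ⊙ δ + (S/24) δ ⊙ δ` in a frame computing the Ricci
contraction and the scalar curvature, for a `C²` metric: the three parts are pairwise orthogonal
(`sum_weylFrame_mul_kulkarniNomizu_frameDelta_eq_zero` for `W ⟂ E ⊙ δ`, `W ⟂ δ ⊙ δ`;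
`⟨E ⊙ δ, δ ⊙ δ⟩ = 24 tr E = 0`), `|E ⊙ δ|² = 8|E|²` and `|δ ⊙ δ|² = 96`
(Besse 1987, Thm. 1.114 and 1.116–1.117). [cite: Besse1987, Thm. 1.114]
[cite: ChangGurskyYang2003, (0.1)] -/
theorem _root_.Literature.Geometry.Lorentzian.PseudoRiemannianMetric.curvNormSqFrame_eq_of_frame
    (hn : 2 ≤ n) (x : M) (e : Fin 4 → TangentSpace I x)
    (hRic : ∀ a b, ∑ i, g.curvatureForm g.leviCivita x (e i) (e a) (e b) (e i) = g.ricci x (e a) (e b))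
    (hS : ∑ i, g.ricci x (e i) (e i) = g.scalarCurvature x) :
    g.curvNormSqFrame x e =
      g.weylNormSqFrame x e + 2 * g.tracelessRicciNormSqFrame x e + g.scalarCurvature x ^ 2 / 6 := by
  set W := g.weylFrame x e with hW
  set P := kulkarniNomizu (g.tracelessRicciFrame x e) frameDelta with hP
  set Q := kulkarniNomizu (frameDelta (ι := Fin 4)) frameDelta with hQ
  set S := g.scalarCurvature x with hSdef
  -- (0.1), squared term by term
  have hsq : ∀ i j k l, g.curvatureForm g.leviCivita x (e i) (e j) (e k) (e l) ^ 2 =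
      W i j k l ^ 2 + 1 / 4 * P i j k l ^ 2 + S ^ 2 / 576 * Q i j k l ^ 2 +
        W i j k l * P i j k l + S / 12 * (W i j k l * Q i j k l) +
        S / 24 * (P i j k l * Q i j k l) := by
    intro i j k l
    rw [g.curvatureForm_eq_weylFrame_add x e i j k l]
    ring
  -- the cross terms vanish, the squares are `8|E|²` and `96`
  have hWP : ∑ i, ∑ j, ∑ k, ∑ l, W i j k l * P i j k l = 0 :=
    g.sum_weylFrame_mul_kulkarniNomizu_frameDelta_eq_zero hn x e hRic hS _
  have hWQ : ∑ i, ∑ j, ∑ k, ∑ l, W i j k l * Q i j k l = 0 :=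
    g.sum_weylFrame_mul_kulkarniNomizu_frameDelta_eq_zero hn x e hRic hS _
  have hPQ : ∑ i, ∑ j, ∑ k, ∑ l, P i j k l * Q i j k l = 0 := by
    rw [hP, hQ, sum_kulkarniNomizu_frameDelta_mul_kulkarniNomizu_frameDelta,
      g.sum_tracelessRicciFrame_diag x e hS, mul_zero]
  have hPP : ∑ i, ∑ j, ∑ k, ∑ l, P i j k l ^ 2 = 8 * g.tracelessRicciNormSqFrame x e := by
    rw [hP, sum_kulkarniNomizu_frameDelta_sq, g.sum_tracelessRicciFrame_diag x e hS]
    simp [tracelessRicciNormSqFrame]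
  have hQQ : ∑ i, ∑ j, ∑ k, ∑ l, Q i j k l ^ 2 = 96 := sum_kulkarniNomizu_frameDelta_frameDelta_sq
  simp only [curvNormSqFrame, weylNormSqFrame, hsq, Finset.sum_add_distrib, ← Finset.mul_sum, hWP,
    hWQ, hPQ, hPP, hQQ]
  ring

/-- **`|W|² = |Rm|² - 2|Ric|² + S²/3` in dimension `4`** (the case `m = 4` of
`|W|² = |Rm|² - (4/(m-2))|Ric|² + (2/((m-1)(m-2))) S²`, Besse 1987, 1.116–1.117; listed as
deferred in `WeylEnergy.lean`), in a frame computing the Ricci contraction and the scalar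
curvature, for a `C²` metric. [cite: Besse1987, (1.116)–1.117] -/
theorem _root_.Literature.Geometry.Lorentzian.PseudoRiemannianMetric.weylNormSqFrame_eq_curvNormSqFrame_of_frame
    (hn : 2 ≤ n) (x : M) (e : Fin 4 → TangentSpace I x)
    (hRic : ∀ a b, ∑ i, g.curvatureForm g.leviCivita x (e i) (e a) (e b) (e i) = g.ricci x (e a) (e b))
    (hS : ∑ i, g.ricci x (e i) (e i) = g.scalarCurvature x) :
    g.weylNormSqFrame x e =
      g.curvNormSqFrame x e - 2 * g.ricciNormSqFrame x e + g.scalarCurvature x ^ 2 / 3 := by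
  rw [g.curvNormSqFrame_eq_of_frame hn x e hRic hS, g.ricciNormSqFrame_eq x e hS]
  ring

end Symmetries

/-! #### `σ₂(A) = -½|E|² + R²/24` and the weak pinching inequality -/

/-- **`σ₂(A) = -½|E|² + R²/24`** in a `4`-frame computing the scalar curvature, for a symmetric
Ricci tensor (Chang–Gursky–Yang 2003, p. 121: "rewriting `σ₂(A)` in terms of the trace-free Ricci
tensor `E = Ric - ¼ R g` and the scalar curvature"; equivalently (0.4) versus (1.1):
`¼|W|² + σ₂(A) = ¼|W|² - ½|E|² + R²/24`). With `t = Σ Ric_{aa}`, the difference of the two sides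
is `¼(2t - R)(t - R)`, which vanishes for `t = R`. [cite: ChangGurskyYang2003, §2, p. 121] -/
theorem _root_.Literature.Geometry.Lorentzian.PseudoRiemannianMetric.sigma2WeylSchoutenFrame_eq
    (x : M) (e : Fin 4 → TangentSpace I x) (hsymm : ∀ a b, g.ricci x (e a) (e b) = g.ricci x (e b) (e a))
    (hS : ∑ i, g.ricci x (e i) (e i) = g.scalarCurvature x) :
    g.sigma2WeylSchoutenFrame x e =
      -(1 / 2) * g.tracelessRicciNormSqFrame x e + g.scalarCurvature x ^ 2 / 24 := by
  have hA : ∀ a b, g.weylSchoutenFrame x e a b * g.weylSchoutenFrame x e b a =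
      g.weylSchoutenFrame x e a b ^ 2 := fun a b ↦ by
    rw [sq, weylSchoutenFrame, weylSchoutenFrame, hsymm b a, frameDelta_comm b a]
  have hA' : ∑ a, ∑ b, g.weylSchoutenFrame x e a b * g.weylSchoutenFrame x e b a =
      ∑ a, ∑ b, g.weylSchoutenFrame x e a b ^ 2 :=
    Finset.sum_congr rfl fun a _ ↦ Finset.sum_congr rfl fun b _ ↦ hA a b
  rw [sigma2WeylSchoutenFrame, hA']
  simp only [tracelessRicciNormSqFrame, tracelessRicciFrame, weylSchoutenFrame, Fintype.card_fin,
    Fin.sum_univ_four, frameDelta, Fin.isValue, Fin.reduceEq, if_true, if_false, mul_one, mul_zero,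
    sub_zero] at hS ⊢
  push_cast
  linear_combination
    (1 / 4 * (2 * (g.ricci x (e 0) (e 0) + g.ricci x (e 1) (e 1) + g.ricci x (e 2) (e 2) +
      g.ricci x (e 3) (e 3)) - g.scalarCurvature x)) * hS

/-- **Pointwise positivity of the (0.5)-integrand is weak pinching** (Chang–Gursky–Yang 2003,
§2, p. 121): in a `4`-frame computing `S` with symmetric Ricci tensor, `σ₂(A) - ¼|W|² > 0`
implies `|W|² + 2|E|² < S²/6`. [cite: ChangGurskyYang2003, §2, p. 121] -/
theorem _root_.Literature.Geometry.Lorentzian.PseudoRiemannianMetric.weylNormSqFrame_add_lt_of_sigma2_sub_pos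
    (x : M) (e : Fin 4 → TangentSpace I x) (hsymm : ∀ a b, g.ricci x (e a) (e b) = g.ricci x (e b) (e a))
    (hS : ∑ i, g.ricci x (e i) (e i) = g.scalarCurvature x)
    (h : 1 / 4 * g.weylNormSqFrame x e < g.sigma2WeylSchoutenFrame x e) :
    g.weylNormSqFrame x e + 2 * g.tracelessRicciNormSqFrame x e < g.scalarCurvature x ^ 2 / 6 :=
  weakPinching_of_sigma2_sub_pos (g.sigma2WeylSchoutenFrame_eq x e hsymm hS) h

/-! #### The same statements for orthonormal bases of a Riemannian metric -/

section Orthonormal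

/-- In an orthonormal `4`-frame of a metric on a `4`-dimensional model space the frame computes
the Ricci contraction: `Σᵢ Rm(eᵢ, e_a, e_b, eᵢ) = Ric(e_a, e_b)` (O'Neill 1983, Lemma 3.52, via
`ricci_eq_sum_of_isOrthonormalFrame`). [cite: ONeill1983, Ch. 3, Lemma 3.52] -/
theorem _root_.Literature.Geometry.Lorentzian.PseudoRiemannianMetric.IsOrthonormalFrame.sum_curvatureForm_eq_ricci
    {x : M} {e : Fin 4 → TangentSpace I x} (he : g.IsOrthonormalFrame x e) (hE : finrank ℝ E = 4)
    (a b : Fin 4) :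
    ∑ i, g.curvatureForm g.leviCivita x (e i) (e a) (e b) (e i) = g.ricci x (e a) (e b) := by
  have hι : Fintype.card (Fin 4) = finrank ℝ E := by rw [Fintype.card_fin, hE]
  have h := g.ricci_eq_sum_of_isOrthonormalFrame (he.toBasis hι)
    (by rw [he.coe_toBasis hι]; exact he) g.leviCivita (e a) (e b)
  rw [he.coe_toBasis hι] at h
  exact h.symm

/-- In an orthonormal `4`-frame of a metric on a `4`-dimensional model space the frame computes
the scalar curvature: `Σᵢ Ric(eᵢ, eᵢ) = S` (O'Neill 1983, Def. 3.53, via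
`trace_eq_sum_of_isOrthonormalFrame`). [cite: ONeill1983, Ch. 3, Def. 3.53] -/
theorem _root_.Literature.Geometry.Lorentzian.PseudoRiemannianMetric.IsOrthonormalFrame.sum_ricci_eq_scalarCurvature
    {x : M} {e : Fin 4 → TangentSpace I x} (he : g.IsOrthonormalFrame x e) (hE : finrank ℝ E = 4) :
    ∑ i, g.ricci x (e i) (e i) = g.scalarCurvature x := by
  have hι : Fintype.card (Fin 4) = finrank ℝ E := by rw [Fintype.card_fin, hE]
  have h := g.trace_eq_sum_of_isOrthonormalFrame (he.toBasis hι)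
    (by rw [he.coe_toBasis hι]; exact he) (g.ricci x)
  rw [he.coe_toBasis hι] at h
  exact h.symm

variable [Fact (1 ≤ n)] [CompleteSpace E]

/-- **(0.2) in an orthonormal frame**: `|Z|² = |W|² + 2|E|²` in every `g_x`-orthonormal `4`-frame
of a `C²` metric on a `4`-dimensional model space. [cite: ChangGurskyYang2003, (0.2)] -/
theorem _root_.Literature.Geometry.Lorentzian.PseudoRiemannianMetric.zNormSqFrame_eq (hn : 2 ≤ n)
    (hE : finrank ℝ E = 4) {x : M} {e : Fin 4 → TangentSpace I x} (he : g.IsOrthonormalFrame x e) :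
    g.zNormSqFrame x e = g.weylNormSqFrame x e + 2 * g.tracelessRicciNormSqFrame x e :=
  g.zNormSqFrame_eq_of_frame hn x e (he.sum_curvatureForm_eq_ricci g hE)
    (he.sum_ricci_eq_scalarCurvature g hE)

/-- **`|Rm|² = |W|² + 2|E|² + S²/6` in an orthonormal frame** of a `C²` metric on a
`4`-dimensional model space. [cite: Besse1987, Thm. 1.114] -/
theorem _root_.Literature.Geometry.Lorentzian.PseudoRiemannianMetric.curvNormSqFrame_eq (hn : 2 ≤ n)
    (hE : finrank ℝ E = 4) {x : M} {e : Fin 4 → TangentSpace I x} (he : g.IsOrthonormalFrame x e) :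
    g.curvNormSqFrame x e =
      g.weylNormSqFrame x e + 2 * g.tracelessRicciNormSqFrame x e + g.scalarCurvature x ^ 2 / 6 :=
  g.curvNormSqFrame_eq_of_frame hn x e (he.sum_curvatureForm_eq_ricci g hE)
    (he.sum_ricci_eq_scalarCurvature g hE)

/-- **`|W|² = |Rm|² - 2|Ric|² + S²/3` in an orthonormal frame** of a `C²` metric on a
`4`-dimensional model space. [cite: Besse1987, (1.116)–1.117] -/
theorem _root_.Literature.Geometry.Lorentzian.PseudoRiemannianMetric.weylNormSqFrame_eq_curvNormSqFrame
    (hn : 2 ≤ n) (hE : finrank ℝ E = 4) {x : M} {e : Fin 4 → TangentSpace I x}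
    (he : g.IsOrthonormalFrame x e) :
    g.weylNormSqFrame x e =
      g.curvNormSqFrame x e - 2 * g.ricciNormSqFrame x e + g.scalarCurvature x ^ 2 / 3 :=
  g.weylNormSqFrame_eq_curvNormSqFrame_of_frame hn x e (he.sum_curvatureForm_eq_ricci g hE)
    (he.sum_ricci_eq_scalarCurvature g hE)

/-- **`σ₂(A) = -½|E|² + R²/24` in an orthonormal frame** of a `C²` metric on a `4`-dimensional
model space (Ricci symmetry: `ricci_symm_holds`). [cite: ChangGurskyYang2003, §2, p. 121] -/
theorem _root_.Literature.Geometry.Lorentzian.PseudoRiemannianMetric.sigma2WeylSchoutenFrame_eq_of_isOrthonormalFrame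
    (hn : 2 ≤ n) (hE : finrank ℝ E = 4) {x : M} {e : Fin 4 → TangentSpace I x}
    (he : g.IsOrthonormalFrame x e) :
    g.sigma2WeylSchoutenFrame x e =
      -(1 / 2) * g.tracelessRicciNormSqFrame x e + g.scalarCurvature x ^ 2 / 24 :=
  g.sigma2WeylSchoutenFrame_eq x e (fun a b ↦ (g.ricci_symm_holds hn x).eq (e a) (e b))
    (he.sum_ricci_eq_scalarCurvature g hE)

/-- **Weak pinching from pointwise positivity, orthonormal-frame form** (Chang–Gursky–Yang 2003,
§2, p. 121): `σ₂(A) - ¼|W|² > 0` in a `g_x`-orthonormal `4`-frame of a `C²` metric on a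
`4`-dimensional model gives `|W|² + 2|E|² < S²/6` there. [cite: ChangGurskyYang2003, §2, p. 121] -/
theorem _root_.Literature.Geometry.Lorentzian.PseudoRiemannianMetric.IsOrthonormalFrame.weakPinching_of_sigma2_sub_pos
    (hn : 2 ≤ n) (hE : finrank ℝ E = 4) {x : M} {e : Fin 4 → TangentSpace I x}
    (he : g.IsOrthonormalFrame x e)
    (h : 1 / 4 * g.weylNormSqFrame x e < g.sigma2WeylSchoutenFrame x e) :
    g.weylNormSqFrame x e + 2 * g.tracelessRicciNormSqFrame x e < g.scalarCurvature x ^ 2 / 6 :=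
  g.weylNormSqFrame_add_lt_of_sigma2_sub_pos x e (fun a b ↦ (g.ricci_symm_holds hn x).eq (e a) (e b))
    (he.sum_ricci_eq_scalarCurvature g hE) h

end Orthonormal

/-! #### Frame independence of `|W|²`: `weylNormSq` is the frame value -/

section FrameIndependence

omit [FiniteDimensional ℝ E] [g.HasLeviCivita] in
/-- **Parseval for a functional against a vector**: `Σᵢ α(bᵢ) g(w, bᵢ) = α(w)` for a
`g_x`-orthonormal basis `b` (orthonormal expansion `w = Σᵢ g(w, bᵢ) bᵢ`, O'Neill 1983, Ch. 2,
Lemma 25). [cite: ONeill1983, Ch. 2, Lemma 25 (p. 50)] -/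
theorem _root_.Literature.Geometry.Lorentzian.PseudoRiemannianMetric.sum_apply_mul_val_of_isOrthonormalFrame
    {x : M} {ι : Type*} [Fintype ι] (b : Basis ι ℝ (TangentSpace I x))
    (hb : g.IsOrthonormalFrame x b) (α : TangentSpace I x →ₗ[ℝ] ℝ) (w : TangentSpace I x) :
    ∑ i, α (b i) * g.val x w (b i) = α w := by
  conv_rhs => rw [← b.sum_repr w]
  rw [map_sum]
  refine Finset.sum_congr rfl fun i _ ↦ ?_
  rw [map_smul, g.basis_repr_of_isOrthonormalFrame b hb w i, smul_eq_mul, mul_comm]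

omit [g.HasLeviCivita] in
/-- **`Σᵢ α(bᵢ)² = α(α♯)` is frame independent**: the sum of squares of the values of a linear
functional on a `g_x`-orthonormal basis is `α(♯α)` (`♯` the musical isomorphism of `g_x`,
`g(♯α, v) = α(v)`), hence the same for all orthonormal bases. [cite: ONeill1983, Ch. 3, p. 60] -/
theorem _root_.Literature.Geometry.Lorentzian.PseudoRiemannianMetric.sum_sq_apply_of_isOrthonormalFrame
    {x : M} {ι : Type*} [Fintype ι] (b : Basis ι ℝ (TangentSpace I x))
    (hb : g.IsOrthonormalFrame x b) (α : TangentSpace I x →ₗ[ℝ] ℝ) :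
    ∑ i, α (b i) ^ 2 = α (g.sharp x α) := by
  rw [← g.sum_apply_mul_val_of_isOrthonormalFrame b hb α (g.sharp x α)]
  refine Finset.sum_congr rfl fun i _ ↦ ?_
  rw [sq, val_sharp_apply]

omit [g.HasLeviCivita] in
/-- **Frame independence of the squared norm of a `4`-linear form**:
`Σ_{ijkl} T(bᵢ,bⱼ,b_k,b_l)²` is the same for any two `g_x`-orthonormal bases `b`, `b'` (slot by
slot, by `sum_sq_apply_of_isOrthonormalFrame`). Elementary linear algebra (the full contraction of
`T ⊗ T` with `g_x`). [folklore] -/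
theorem _root_.Literature.Geometry.Lorentzian.PseudoRiemannianMetric.sum_sq_fourLinear_eq_of_isOrthonormalFrame
    {x : M} {ι ι' : Type*} [Fintype ι] [Fintype ι'] (b : Basis ι ℝ (TangentSpace I x))
    (hb : g.IsOrthonormalFrame x b) (b' : Basis ι' ℝ (TangentSpace I x))
    (hb' : g.IsOrthonormalFrame x b')
    (T : TangentSpace I x → TangentSpace I x → TangentSpace I x → TangentSpace I x → ℝ)
    (h₁ : ∀ Y Z V, IsLinearMap ℝ fun X ↦ T X Y Z V) (h₂ : ∀ X Z V, IsLinearMap ℝ fun Y ↦ T X Y Z V)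
    (h₃ : ∀ X Y V, IsLinearMap ℝ fun Z ↦ T X Y Z V) (h₄ : ∀ X Y Z, IsLinearMap ℝ fun V ↦ T X Y Z V) :
    ∑ i, ∑ j, ∑ k, ∑ l, T (b i) (b j) (b k) (b l) ^ 2 =
      ∑ i, ∑ j, ∑ k, ∑ l, T (b' i) (b' j) (b' k) (b' l) ^ 2 := by
  have S : ∀ α : TangentSpace I x →ₗ[ℝ] ℝ, ∑ i, α (b i) ^ 2 = ∑ i, α (b' i) ^ 2 := fun α ↦ by
    rw [g.sum_sq_apply_of_isOrthonormalFrame b hb, g.sum_sq_apply_of_isOrthonormalFrame b' hb']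
  have e₁ : ∀ Y Z V, ∑ i, T (b i) Y Z V ^ 2 = ∑ i, T (b' i) Y Z V ^ 2 := fun Y Z V ↦ by
    simpa using S ((h₁ Y Z V).mk' _)
  have e₂ : ∀ X Z V, ∑ i, T X (b i) Z V ^ 2 = ∑ i, T X (b' i) Z V ^ 2 := fun X Z V ↦ by
    simpa using S ((h₂ X Z V).mk' _)
  have e₃ : ∀ X Y V, ∑ i, T X Y (b i) V ^ 2 = ∑ i, T X Y (b' i) V ^ 2 := fun X Y V ↦ by
    simpa using S ((h₃ X Y V).mk' _)
  have e₄ : ∀ X Y Z, ∑ i, T X Y Z (b i) ^ 2 = ∑ i, T X Y Z (b' i) ^ 2 := fun X Y Z ↦ by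
    simpa using S ((h₄ X Y Z).mk' _)
  calc ∑ i, ∑ j, ∑ k, ∑ l, T (b i) (b j) (b k) (b l) ^ 2
      = ∑ i, ∑ j, ∑ k, ∑ l, T (b i) (b j) (b k) (b' l) ^ 2 := by simp only [e₄]
    _ = ∑ i, ∑ j, ∑ l, ∑ k, T (b i) (b j) (b k) (b' l) ^ 2 := by
        refine Finset.sum_congr rfl fun _ _ ↦ Finset.sum_congr rfl fun _ _ ↦ ?_
        exact Finset.sum_comm
    _ = ∑ i, ∑ j, ∑ l, ∑ k, T (b i) (b j) (b' k) (b' l) ^ 2 := by simp only [e₃]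
    _ = ∑ i, ∑ l, ∑ j, ∑ k, T (b i) (b j) (b' k) (b' l) ^ 2 := by
        refine Finset.sum_congr rfl fun _ _ ↦ ?_
        exact Finset.sum_comm
    _ = ∑ i, ∑ l, ∑ k, ∑ j, T (b i) (b j) (b' k) (b' l) ^ 2 := by
        refine Finset.sum_congr rfl fun _ _ ↦ Finset.sum_congr rfl fun _ _ ↦ ?_
        exact Finset.sum_comm
    _ = ∑ i, ∑ l, ∑ k, ∑ j, T (b i) (b' j) (b' k) (b' l) ^ 2 := by simp only [e₂]
    _ = ∑ l, ∑ i, ∑ k, ∑ j, T (b i) (b' j) (b' k) (b' l) ^ 2 := Finset.sum_comm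
    _ = ∑ l, ∑ k, ∑ i, ∑ j, T (b i) (b' j) (b' k) (b' l) ^ 2 := by
        refine Finset.sum_congr rfl fun _ _ ↦ ?_
        exact Finset.sum_comm
    _ = ∑ l, ∑ k, ∑ j, ∑ i, T (b i) (b' j) (b' k) (b' l) ^ 2 := by
        refine Finset.sum_congr rfl fun _ _ ↦ Finset.sum_congr rfl fun _ _ ↦ ?_
        exact Finset.sum_comm
    _ = ∑ l, ∑ k, ∑ j, ∑ i, T (b' i) (b' j) (b' k) (b' l) ^ 2 := by simp only [e₁]
    _ = ∑ l, ∑ k, ∑ i, ∑ j, T (b' i) (b' j) (b' k) (b' l) ^ 2 := by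
        refine Finset.sum_congr rfl fun _ _ ↦ Finset.sum_congr rfl fun _ _ ↦ ?_
        exact Finset.sum_comm
    _ = ∑ l, ∑ i, ∑ k, ∑ j, T (b' i) (b' j) (b' k) (b' l) ^ 2 := by
        refine Finset.sum_congr rfl fun _ _ ↦ ?_
        exact Finset.sum_comm
    _ = ∑ i, ∑ l, ∑ k, ∑ j, T (b' i) (b' j) (b' k) (b' l) ^ 2 := Finset.sum_comm
    _ = ∑ i, ∑ l, ∑ j, ∑ k, T (b' i) (b' j) (b' k) (b' l) ^ 2 := by
        refine Finset.sum_congr rfl fun _ _ ↦ Finset.sum_congr rfl fun _ _ ↦ ?_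
        exact Finset.sum_comm
    _ = ∑ i, ∑ j, ∑ l, ∑ k, T (b' i) (b' j) (b' k) (b' l) ^ 2 := by
        refine Finset.sum_congr rfl fun _ _ ↦ ?_
        exact Finset.sum_comm
    _ = ∑ i, ∑ j, ∑ k, ∑ l, T (b' i) (b' j) (b' k) (b' l) ^ 2 := by
        refine Finset.sum_congr rfl fun _ _ ↦ Finset.sum_congr rfl fun _ _ ↦ ?_
        exact Finset.sum_comm

section WeylTensor

/-- **The Weyl tensor as a `4`-linear function on `T_x M`** (Besse 1987, (1.116)–1.117; in the
tree's slot convention, `m = dim E`):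
`𝒲(X,Y,Z,V) = Rm(X,Y,Z,V) - (1/(m-2)) (Ric(X,V) g(Y,Z) + Ric(Y,Z) g(X,V) - Ric(X,Z) g(Y,V) - Ric(Y,V) g(X,Z))
  + (S/((m-1)(m-2))) (g(X,V) g(Y,Z) - g(X,Z) g(Y,V))`;
its components in a `g_x`-orthonormal basis are `weylFrame` (`weylFrame_eq_weylTensor`).
[cite: Besse1987, (1.116)–1.117] -/
def _root_.Literature.Geometry.Lorentzian.PseudoRiemannianMetric.weylTensor (x : M)
    (X Y Z V : TangentSpace I x) : ℝ :=
  g.curvatureForm g.leviCivita x X Y Z V -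
    1 / ((finrank ℝ E : ℝ) - 2) *
      (g.ricci x X V * g.val x Y Z + g.ricci x Y Z * g.val x X V -
        g.ricci x X Z * g.val x Y V - g.ricci x Y V * g.val x X Z) +
    g.scalarCurvature x / (((finrank ℝ E : ℝ) - 1) * ((finrank ℝ E : ℝ) - 2)) *
      (g.val x X V * g.val x Y Z - g.val x X Z * g.val x Y V)

omit [FiniteDimensional ℝ E] [g.HasLeviCivita] in
/-- In an orthonormal frame `g(e_a, e_b) = δ_{ab}`. [folklore] -/
theorem _root_.Literature.Geometry.Lorentzian.PseudoRiemannianMetric.IsOrthonormalFrame.val_eq_ite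
    {x : M} {ι : Type*} [DecidableEq ι] {e : ι → TangentSpace I x} (he : g.IsOrthonormalFrame x e)
    (a b : ι) : g.val x (e a) (e b) = if a = b then 1 else 0 := by
  split_ifs with h
  · subst h; exact he.1 a
  · exact he.2 a b h

/-- **The frame Weyl tensor is the Weyl tensor on the frame**: for a `g_x`-orthonormal frame of
size `dim E`, `weylFrame x e i j k l = 𝒲(eᵢ, eⱼ, e_k, e_l)`. [cite: Besse1987, (1.116)] -/
theorem _root_.Literature.Geometry.Lorentzian.PseudoRiemannianMetric.weylFrame_eq_weylTensor
    {x : M} {ι : Type*} [Fintype ι] [DecidableEq ι] {e : ι → TangentSpace I x}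
    (he : g.IsOrthonormalFrame x e) (hι : Fintype.card ι = finrank ℝ E) (i j k l : ι) :
    g.weylFrame x e i j k l = g.weylTensor x (e i) (e j) (e k) (e l) := by
  simp only [weylFrame_apply, weylTensor, he.val_eq_ite, hι]

/-- `𝒲` is linear in its first slot. [folklore] -/
theorem _root_.Literature.Geometry.Lorentzian.PseudoRiemannianMetric.isLinearMap_weylTensor₁ (x : M)
    (Y Z V : TangentSpace I x) : IsLinearMap ℝ fun X ↦ g.weylTensor x X Y Z V := by
  constructor
  · intro X X'
    simp only [weylTensor, curvatureForm, map_add, _root_.add_apply, LinearMap.add_apply]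
    ring
  · intro c X
    simp only [weylTensor, curvatureForm, map_smul, _root_.smul_apply, LinearMap.smul_apply, smul_eq_mul]
    ring

/-- `𝒲` is linear in its second slot. [folklore] -/
theorem _root_.Literature.Geometry.Lorentzian.PseudoRiemannianMetric.isLinearMap_weylTensor₂ (x : M)
    (X Z V : TangentSpace I x) : IsLinearMap ℝ fun Y ↦ g.weylTensor x X Y Z V := by
  constructor
  · intro Y Y'
    simp only [weylTensor, curvatureForm, map_add, _root_.add_apply, LinearMap.add_apply]
    ring
  · intro c Y
    simp only [weylTensor, curvatureForm, map_smul, _root_.smul_apply, LinearMap.smul_apply, smul_eq_mul]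
    ring

/-- `𝒲` is linear in its third slot. [folklore] -/
theorem _root_.Literature.Geometry.Lorentzian.PseudoRiemannianMetric.isLinearMap_weylTensor₃ (x : M)
    (X Y V : TangentSpace I x) : IsLinearMap ℝ fun Z ↦ g.weylTensor x X Y Z V := by
  constructor
  · intro Z Z'
    simp only [weylTensor, curvatureForm, map_add, _root_.add_apply]
    ring
  · intro c Z
    simp only [weylTensor, curvatureForm, map_smul, _root_.smul_apply, smul_eq_mul]
    ring

/-- `𝒲` is linear in its fourth slot. [folklore] -/
theorem _root_.Literature.Geometry.Lorentzian.PseudoRiemannianMetric.isLinearMap_weylTensor₄ (x : M)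
    (X Y Z : TangentSpace I x) : IsLinearMap ℝ fun V ↦ g.weylTensor x X Y Z V := by
  constructor
  · intro V V'
    simp only [weylTensor, curvatureForm, map_add]
    ring
  · intro c V
    simp only [weylTensor, curvatureForm, map_smul, smul_eq_mul]
    ring

/-- **Frame independence of `|W|²`** (WeylEnergy.lean, "elementary linear algebra"): the frame
expression `Σ W_{ijkl}²` takes the same value on any two `g_x`-orthonormal bases of size `dim E`.
[cite: ChangGurskyYang2003, Thm. A, Remark 2] -/
theorem _root_.Literature.Geometry.Lorentzian.PseudoRiemannianMetric.weylNormSqFrame_eq_of_isOrthonormalFrame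
    {x : M} {ι ι' : Type*} [Fintype ι] [Fintype ι'] [DecidableEq ι] [DecidableEq ι']
    {e : ι → TangentSpace I x} (he : g.IsOrthonormalFrame x e) (hι : Fintype.card ι = finrank ℝ E)
    {e' : ι' → TangentSpace I x} (he' : g.IsOrthonormalFrame x e')
    (hι' : Fintype.card ι' = finrank ℝ E) :
    g.weylNormSqFrame x e = g.weylNormSqFrame x e' := by
  simp only [weylNormSqFrame, g.weylFrame_eq_weylTensor he hι, g.weylFrame_eq_weylTensor he' hι']
  have h := g.sum_sq_fourLinear_eq_of_isOrthonormalFrame (he.toBasis hι)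
    (by rw [he.coe_toBasis hι]; exact he) (he'.toBasis hι') (by rw [he'.coe_toBasis hι']; exact he')
    (g.weylTensor x) (g.isLinearMap_weylTensor₁ x) (g.isLinearMap_weylTensor₂ x)
    (g.isLinearMap_weylTensor₃ x) (g.isLinearMap_weylTensor₄ x)
  simpa only [he.coe_toBasis hι, he'.coe_toBasis hι'] using h

/-- **`|W_g|²(x)` is the frame value**: for every `g_x`-orthonormal frame `e` of size `dim E`
(indexed by `Fin (dim E)`, as in the definition), `weylNormSq x = Σ_{ijkl} W_{ijkl}(e)²` — the
supremum in the definition of `weylNormSq` (`WeylEnergy.lean`) is over a constant nonempty family.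
[cite: ChangGurskyYang2003, Thm. A, Remark 2] -/
theorem _root_.Literature.Geometry.Lorentzian.PseudoRiemannianMetric.weylNormSq_eq_weylNormSqFrame
    {x : M} {e : Fin (finrank ℝ E) → TangentSpace I x} (he : g.IsOrthonormalFrame x e) :
    g.weylNormSq x = g.weylNormSqFrame x e := by
  haveI : Nonempty {e : Fin (finrank ℝ E) → TangentSpace I x // g.IsOrthonormalFrame x e} :=
    ⟨⟨e, he⟩⟩
  have hconst : (fun e' : {e : Fin (finrank ℝ E) → TangentSpace I x // g.IsOrthonormalFrame x e} ↦
      g.weylNormSqFrame x e'.1) = fun _ ↦ g.weylNormSqFrame x e :=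
    funext fun e' ↦ g.weylNormSqFrame_eq_of_isOrthonormalFrame e'.2 (Fintype.card_fin _) he
      (Fintype.card_fin _)
  unfold weylNormSq
  rw [hconst, ciSup_const]

/-- Reindexing a frame along an equivalence permutes the Weyl components. [folklore] -/
theorem _root_.Literature.Geometry.Lorentzian.PseudoRiemannianMetric.weylFrame_comp_equiv (x : M)
    {ι κ : Type*} [Fintype ι] [Fintype κ] [DecidableEq ι] [DecidableEq κ] (σ : ι ≃ κ)
    (e : κ → TangentSpace I x) (i j k l : ι) :
    g.weylFrame x (e ∘ σ) i j k l = g.weylFrame x e (σ i) (σ j) (σ k) (σ l) := by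
  simp only [weylFrame_apply, Function.comp_apply, Fintype.card_congr σ, σ.injective.eq_iff]

/-- Reindexing a frame along an equivalence does not change `Σ W_{ijkl}²`. [folklore] -/
theorem _root_.Literature.Geometry.Lorentzian.PseudoRiemannianMetric.weylNormSqFrame_comp_equiv (x : M)
    {ι κ : Type*} [Fintype ι] [Fintype κ] [DecidableEq ι] [DecidableEq κ] (σ : ι ≃ κ)
    (e : κ → TangentSpace I x) : g.weylNormSqFrame x (e ∘ σ) = g.weylNormSqFrame x e := by
  simp only [weylNormSqFrame, g.weylFrame_comp_equiv x σ e]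
  exact Fintype.sum_equiv σ _ _ fun i ↦ Fintype.sum_equiv σ _ _ fun j ↦
    Fintype.sum_equiv σ _ _ fun k ↦ Fintype.sum_equiv σ _ _ fun l ↦ rfl

/-- **`|W_g|²(x)` in any orthonormal `4`-frame, on a `4`-dimensional model**: for
`dim E = 4` and every `g_x`-orthonormal `e : Fin 4 → T_x M`, `weylNormSq x = Σ_{ijkl} W_{ijkl}(e)²`.
This makes the integrand of the Weyl energy `∫|W|² dV` (`weylEnergy`, the quantity of
Chang–Gursky–Yang's (0.3)) computable in frames. [cite: ChangGurskyYang2003, Thm. A, Remark 2] -/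
theorem _root_.Literature.Geometry.Lorentzian.PseudoRiemannianMetric.weylNormSq_eq_weylNormSqFrame_four
    (hE : finrank ℝ E = 4) {x : M} {e : Fin 4 → TangentSpace I x} (he : g.IsOrthonormalFrame x e) :
    g.weylNormSq x = g.weylNormSqFrame x e := by
  set σ : Fin (finrank ℝ E) ≃ Fin 4 := finCongr hE
  have he' : g.IsOrthonormalFrame x (e ∘ σ) := he.comp σ.injective
  rw [g.weylNormSq_eq_weylNormSqFrame he', g.weylNormSqFrame_comp_equiv x σ e]

end WeylTensor

/-! #### Frame independence of `|E|²`; the pointwise norms `|E|²(x)` and weak pinching `WP(x)` -/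

section TracelessRicci

omit [g.HasLeviCivita] in
/-- **Frame independence of the squared norm of a bilinear form**: `Σ_{ab} B(b_a, b_b)²` is the
same for any two `g_x`-orthonormal bases (slot by slot, by `sum_sq_apply_of_isOrthonormalFrame`).
[folklore] -/
theorem _root_.Literature.Geometry.Lorentzian.PseudoRiemannianMetric.sum_sq_bilinForm_eq_of_isOrthonormalFrame
    {x : M} {ι ι' : Type*} [Fintype ι] [Fintype ι'] (b : Basis ι ℝ (TangentSpace I x))
    (hb : g.IsOrthonormalFrame x b) (b' : Basis ι' ℝ (TangentSpace I x))
    (hb' : g.IsOrthonormalFrame x b') (B : LinearMap.BilinForm ℝ (TangentSpace I x)) :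
    ∑ i, ∑ j, B (b i) (b j) ^ 2 = ∑ i, ∑ j, B (b' i) (b' j) ^ 2 := by
  have S : ∀ α : TangentSpace I x →ₗ[ℝ] ℝ, ∑ i, α (b i) ^ 2 = ∑ i, α (b' i) ^ 2 := fun α ↦ by
    rw [g.sum_sq_apply_of_isOrthonormalFrame b hb, g.sum_sq_apply_of_isOrthonormalFrame b' hb']
  have e₂ : ∀ X, ∑ j, B X (b j) ^ 2 = ∑ j, B X (b' j) ^ 2 := fun X ↦ S (B X)
  have e₁ : ∀ Y, ∑ i, B (b i) Y ^ 2 = ∑ i, B (b' i) Y ^ 2 := fun Y ↦ by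
    simpa using S (B.flip Y)
  calc ∑ i, ∑ j, B (b i) (b j) ^ 2 = ∑ i, ∑ j, B (b i) (b' j) ^ 2 := by simp only [e₂]
    _ = ∑ j, ∑ i, B (b i) (b' j) ^ 2 := Finset.sum_comm
    _ = ∑ j, ∑ i, B (b' i) (b' j) ^ 2 := by simp only [e₁]
    _ = ∑ i, ∑ j, B (b' i) (b' j) ^ 2 := Finset.sum_comm

/-- **The trace-free Ricci tensor `E = Ric - (S/m) g` as a bilinear form on `T_x M`**
(`m = dim E`; Chang–Gursky–Yang 2003, (0.1): `E = Ric - ¼ R g`; Margerin's `z = ric - (scal/4) g`).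
Its components in an orthonormal basis are `tracelessRicciFrame`
(`tracelessRicciFrame_eq_tracelessRicci`). [cite: ChangGurskyYang2003, (0.1)]
[cite: Margerin1998, Part I, p. 24] -/
def _root_.Literature.Geometry.Lorentzian.PseudoRiemannianMetric.tracelessRicci (x : M) :
    LinearMap.BilinForm ℝ (TangentSpace I x) :=
  g.ricci x - (g.scalarCurvature x / finrank ℝ E) • g.toBilinForm x

/-- Unfolding: `E(X,Y) = Ric(X,Y) - (S/m) g(X,Y)`. [cite: ChangGurskyYang2003, (0.1)] -/
@[simp] theorem _root_.Literature.Geometry.Lorentzian.PseudoRiemannianMetric.tracelessRicci_apply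
    (x : M) (X Y : TangentSpace I x) :
    g.tracelessRicci x X Y = g.ricci x X Y - g.scalarCurvature x / finrank ℝ E * g.val x X Y := by
  simp [tracelessRicci]

/-- **The frame trace-free Ricci tensor is `E` on the frame**, for an orthonormal frame of size
`dim E`. [cite: ChangGurskyYang2003, (0.1)] -/
theorem _root_.Literature.Geometry.Lorentzian.PseudoRiemannianMetric.tracelessRicciFrame_eq_tracelessRicci
    {x : M} {ι : Type*} [Fintype ι] [DecidableEq ι] {e : ι → TangentSpace I x}
    (he : g.IsOrthonormalFrame x e) (hι : Fintype.card ι = finrank ℝ E) (a b : ι) :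
    g.tracelessRicciFrame x e a b = g.tracelessRicci x (e a) (e b) := by
  rw [tracelessRicciFrame_apply, tracelessRicci_apply, he.val_eq_ite, hι, frameDelta]

/-- **Frame independence of `|E|²`**: `Σ_{ab} E_{ab}²` takes the same value on any two
orthonormal bases of size `dim E`. [cite: ChangGurskyYang2003, (0.2)] -/
theorem _root_.Literature.Geometry.Lorentzian.PseudoRiemannianMetric.tracelessRicciNormSqFrame_eq_of_isOrthonormalFrame
    {x : M} {ι ι' : Type*} [Fintype ι] [Fintype ι'] [DecidableEq ι] [DecidableEq ι']
    {e : ι → TangentSpace I x} (he : g.IsOrthonormalFrame x e) (hι : Fintype.card ι = finrank ℝ E)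
    {e' : ι' → TangentSpace I x} (he' : g.IsOrthonormalFrame x e')
    (hι' : Fintype.card ι' = finrank ℝ E) :
    g.tracelessRicciNormSqFrame x e = g.tracelessRicciNormSqFrame x e' := by
  simp only [tracelessRicciNormSqFrame, g.tracelessRicciFrame_eq_tracelessRicci he hι,
    g.tracelessRicciFrame_eq_tracelessRicci he' hι']
  have h := g.sum_sq_bilinForm_eq_of_isOrthonormalFrame (he.toBasis hι)
    (by rw [he.coe_toBasis hι]; exact he) (he'.toBasis hι') (by rw [he'.coe_toBasis hι']; exact he')
    (g.tracelessRicci x)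
  simpa only [he.coe_toBasis hι, he'.coe_toBasis hι'] using h

/-- **The pointwise squared norm `|E_g|²(x)` of the trace-free Ricci tensor** (Chang–Gursky–Yang
2003, (0.2)): the value of `Σ_{ab} E_{ab}²` (`tracelessRicciNormSqFrame`) on any
`g_x`-orthonormal basis `e : Fin (dim E) → T_x M` — frame independent
(`tracelessRicciNormSqFrame_eq_of_isOrthonormalFrame`), so defined, exactly as `weylNormSq` of
`WeylEnergy.lean`, as the supremum over the (possibly empty) type of orthonormal frames; junk value
`0` where `g_x` has no orthonormal basis. [cite: ChangGurskyYang2003, (0.2)] -/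
def _root_.Literature.Geometry.Lorentzian.PseudoRiemannianMetric.tracelessRicciNormSq (x : M) : ℝ :=
  ⨆ e : {e : Fin (finrank ℝ E) → TangentSpace I x // g.IsOrthonormalFrame x e},
    g.tracelessRicciNormSqFrame x e.1

/-- `|E|²(x) ≥ 0`. [folklore] -/
theorem _root_.Literature.Geometry.Lorentzian.PseudoRiemannianMetric.tracelessRicciNormSq_nonneg
    (x : M) : 0 ≤ g.tracelessRicciNormSq x := by
  unfold tracelessRicciNormSq
  exact Real.iSup_nonneg fun e ↦ g.tracelessRicciNormSqFrame_nonneg x e.1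

/-- **`|E_g|²(x)` is the frame value** on every orthonormal frame of size `dim E`.
[cite: ChangGurskyYang2003, (0.2)] -/
theorem _root_.Literature.Geometry.Lorentzian.PseudoRiemannianMetric.tracelessRicciNormSq_eq_tracelessRicciNormSqFrame
    {x : M} {e : Fin (finrank ℝ E) → TangentSpace I x} (he : g.IsOrthonormalFrame x e) :
    g.tracelessRicciNormSq x = g.tracelessRicciNormSqFrame x e := by
  haveI : Nonempty {e : Fin (finrank ℝ E) → TangentSpace I x // g.IsOrthonormalFrame x e} :=
    ⟨⟨e, he⟩⟩
  have hconst : (fun e' : {e : Fin (finrank ℝ E) → TangentSpace I x // g.IsOrthonormalFrame x e} ↦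
      g.tracelessRicciNormSqFrame x e'.1) = fun _ ↦ g.tracelessRicciNormSqFrame x e :=
    funext fun e' ↦ g.tracelessRicciNormSqFrame_eq_of_isOrthonormalFrame e'.2 (Fintype.card_fin _)
      he (Fintype.card_fin _)
  unfold tracelessRicciNormSq
  rw [hconst, ciSup_const]

/-- Reindexing a frame along an equivalence permutes the components of `E`. [folklore] -/
theorem _root_.Literature.Geometry.Lorentzian.PseudoRiemannianMetric.tracelessRicciFrame_comp_equiv
    (x : M) {ι κ : Type*} [Fintype ι] [Fintype κ] [DecidableEq ι] [DecidableEq κ] (σ : ι ≃ κ)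
    (e : κ → TangentSpace I x) (a b : ι) :
    g.tracelessRicciFrame x (e ∘ σ) a b = g.tracelessRicciFrame x e (σ a) (σ b) := by
  simp only [tracelessRicciFrame_apply, Function.comp_apply, Fintype.card_congr σ, frameDelta,
    σ.injective.eq_iff]

/-- Reindexing a frame along an equivalence does not change `Σ E_{ab}²`. [folklore] -/
theorem _root_.Literature.Geometry.Lorentzian.PseudoRiemannianMetric.tracelessRicciNormSqFrame_comp_equiv
    (x : M) {ι κ : Type*} [Fintype ι] [Fintype κ] [DecidableEq ι] [DecidableEq κ] (σ : ι ≃ κ)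
    (e : κ → TangentSpace I x) :
    g.tracelessRicciNormSqFrame x (e ∘ σ) = g.tracelessRicciNormSqFrame x e := by
  simp only [tracelessRicciNormSqFrame, g.tracelessRicciFrame_comp_equiv x σ e]
  exact Fintype.sum_equiv σ _ _ fun a ↦ Fintype.sum_equiv σ _ _ fun b ↦ rfl

/-- **`|E_g|²(x)` in any orthonormal `4`-frame, on a `4`-dimensional model**.
[cite: ChangGurskyYang2003, (0.2)] -/
theorem _root_.Literature.Geometry.Lorentzian.PseudoRiemannianMetric.tracelessRicciNormSq_eq_tracelessRicciNormSqFrame_four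
    (hE : finrank ℝ E = 4) {x : M} {e : Fin 4 → TangentSpace I x} (he : g.IsOrthonormalFrame x e) :
    g.tracelessRicciNormSq x = g.tracelessRicciNormSqFrame x e := by
  set σ : Fin (finrank ℝ E) ≃ Fin 4 := finCongr hE
  have he' : g.IsOrthonormalFrame x (e ∘ σ) := he.comp σ.injective
  rw [g.tracelessRicciNormSq_eq_tracelessRicciNormSqFrame he',
    g.tracelessRicciNormSqFrame_comp_equiv x σ e]

/-- **Margerin's weak pinching `WP = |Z|²/R² = (|W|² + 2|E|²)/R²` as a function on `M`**
(Chang–Gursky–Yang 2003, (0.2): "the scale-invariant 'weak pinching' quantity"; Margerin 1998,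
Part I, p. 25: `|𝒟|² scal⁻²`), built from the pointwise norms `weylNormSq` and
`tracelessRicciNormSq` and the scalar curvature; Lean's junk value `x/0 = 0` where `S(x) = 0`
(Margerin works with metrics of positive scalar curvature). [cite: ChangGurskyYang2003, (0.2)]
[cite: Margerin1998, Part I, p. 25] -/
def _root_.Literature.Geometry.Lorentzian.PseudoRiemannianMetric.weakPinching (x : M) : ℝ :=
  (g.weylNormSq x + 2 * g.tracelessRicciNormSq x) / g.scalarCurvature x ^ 2

/-- `WP(x) ≥ 0`. [folklore] -/
theorem _root_.Literature.Geometry.Lorentzian.PseudoRiemannianMetric.weakPinching_nonneg (x : M) :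
    0 ≤ g.weakPinching x :=
  div_nonneg (add_nonneg (g.weylNormSq_nonneg x)
    (mul_nonneg zero_le_two (g.tracelessRicciNormSq_nonneg x))) (sq_nonneg _)

/-- **`WP(x)` in an orthonormal `4`-frame** on a `4`-dimensional model:
`WP(x) = (Σ W_{ijkl}² + 2 Σ E_{ab}²)/S(x)²` (by (0.2), `= |Z|²(e)/S²`, `zNormSqFrame_eq`).
[cite: ChangGurskyYang2003, (0.2)] -/
theorem _root_.Literature.Geometry.Lorentzian.PseudoRiemannianMetric.weakPinching_eq_of_isOrthonormalFrame
    (hE : finrank ℝ E = 4) {x : M} {e : Fin 4 → TangentSpace I x} (he : g.IsOrthonormalFrame x e) :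
    g.weakPinching x =
      (g.weylNormSqFrame x e + 2 * g.tracelessRicciNormSqFrame x e) / g.scalarCurvature x ^ 2 := by
  rw [weakPinching, g.weylNormSq_eq_weylNormSqFrame_four hE he,
    g.tracelessRicciNormSq_eq_tracelessRicciNormSqFrame_four hE he]

/-- **`WP < 1/6` pointwise is the frame condition of `hMargerin`**: on a `4`-dimensional model, at a
point where `g_x` is positive definite and `S(x) ≠ 0`, `WP(x) < 1/6` iff
`Σ W² + 2 Σ E² < S²/6` in every (equivalently, in some) `g_x`-orthonormal `4`-frame — the form in
which Margerin's hypothesis enters `changGurskyYang_sphere_four_of_margerin_of_pointwisePinching`.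
[cite: ChangGurskyYang2003, (0.2)] [cite: Margerin1998, Thm. 1] -/
theorem _root_.Literature.Geometry.Lorentzian.PseudoRiemannianMetric.weakPinching_lt_iff
    (hE : finrank ℝ E = 4) {x : M} (hpos : ∀ v : TangentSpace I x, v ≠ 0 → 0 < g.val x v v)
    (hS : g.scalarCurvature x ≠ 0) :
    g.weakPinching x < 1 / 6 ↔ ∀ e : Fin 4 → TangentSpace I x, g.IsOrthonormalFrame x e →
      g.weylNormSqFrame x e + 2 * g.tracelessRicciNormSqFrame x e < g.scalarCurvature x ^ 2 / 6 := by
  have hS2 : 0 < g.scalarCurvature x ^ 2 := by positivity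
  constructor
  · intro h e he
    rw [g.weakPinching_eq_of_isOrthonormalFrame hE he, div_lt_iff₀ hS2] at h
    linarith
  · intro h
    obtain ⟨b, hb⟩ := g.exists_basis_isOrthonormalFrame (x := x) hpos hE
    rw [g.weakPinching_eq_of_isOrthonormalFrame hE hb, div_lt_iff₀ hS2]
    have := h b hb
    linarith

end TracelessRicci

end FrameIndependence

/-! #### Constant sectional curvature: `W = 0`, `|W|² = 0`, zero Weyl energy -/

section ConstantCurvature

variable {g}

omit [FiniteDimensional ℝ E] in
/-- **The Ricci tensor of a constant-curvature pair in an orthonormal basis**: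
`Ric(b_a, b_b) = (m-1) c δ_{ab}` if `(g, ∇^g)` has constant sectional curvature `c`
(`Rm = c (g_{jk} g_{il} - g_{ik} g_{jl})`, Lee 2018, Prop. 8.36: `Rc = (n-1) c g`).
[cite: Lee2018, Prop. 8.36] -/
theorem _root_.Literature.Geometry.Lorentzian.PseudoRiemannianMetric.HasConstantSectionalCurvatureWith.ricci_frame_eq
    {c : ℝ} (h : g.HasConstantSectionalCurvatureWith g.leviCivita c) {x : M} {ι : Type*} [Fintype ι]
    [DecidableEq ι] (b : Basis ι ℝ (TangentSpace I x)) (hb : g.IsOrthonormalFrame x b) (a a' : ι) :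
    g.ricci x (b a) (b a') = ((Fintype.card ι : ℝ) - 1) * c * frameDelta a a' := by
  rw [ricci_apply, g.ricci_eq_sum_of_isOrthonormalFrame b hb g.leviCivita (b a) (b a')]
  have hsummand : ∀ i, g.curvatureForm g.leviCivita x (b i) (b a) (b a') (b i) =
      c * frameDelta a a' - c * (frameDelta i a' * frameDelta a i) := fun i ↦ by
    rw [h.curvatureForm_eq]
    simp only [hb.val_eq_ite, frameDelta, if_true]
    ring
  have hδ : ∑ i, frameDelta i a' * frameDelta a i = frameDelta a a' := by
    rw [Finset.sum_eq_single a']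
    · rw [frameDelta_self, one_mul]
    · intro i _ hi
      rw [frameDelta_of_ne hi, zero_mul]
    · intro ha'
      exact absurd (Finset.mem_univ a') ha'
  simp only [hsummand, Finset.sum_sub_distrib, Finset.sum_const, Finset.card_univ,
    ← Finset.mul_sum, hδ]
  ring

/-- **The scalar curvature of a constant-curvature pair**: `S = m(m-1)c` (trace of
`Ric = (m-1) c g` in an orthonormal basis of size `m`). [cite: Lee2018, Prop. 8.36] -/
theorem _root_.Literature.Geometry.Lorentzian.PseudoRiemannianMetric.HasConstantSectionalCurvatureWith.scalarCurvature_eq_of_basis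
    {c : ℝ} (h : g.HasConstantSectionalCurvatureWith g.leviCivita c) {x : M} {ι : Type*} [Fintype ι]
    [DecidableEq ι] (b : Basis ι ℝ (TangentSpace I x)) (hb : g.IsOrthonormalFrame x b) :
    g.scalarCurvature x = (Fintype.card ι : ℝ) * ((Fintype.card ι : ℝ) - 1) * c := by
  rw [scalarCurvature, g.trace_eq_sum_of_isOrthonormalFrame b hb (g.ricci x)]
  simp only [h.ricci_frame_eq b hb, frameDelta_self, mul_one, Finset.sum_const, Finset.card_univ,
    nsmul_eq_mul]
  ring

/-- **Constant sectional curvature has vanishing Weyl tensor** (Besse 1987, 1.118–1.119: the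
Weyl part of `R = (c/2) g ⊙ g` is zero): in every orthonormal basis of size `m ≥ 3`,
`W_{ijkl} = c(δ_{il}δ_{jk} - δ_{ik}δ_{jl}) (1 - 2(m-1)/(m-2) + m/(m-2)) = 0`.
[cite: Besse1987, 1.118–1.119] -/
theorem _root_.Literature.Geometry.Lorentzian.PseudoRiemannianMetric.HasConstantSectionalCurvatureWith.weylFrame_eq_zero
    {c : ℝ} (h : g.HasConstantSectionalCurvatureWith g.leviCivita c) {x : M} {ι : Type*} [Fintype ι]
    [DecidableEq ι] (b : Basis ι ℝ (TangentSpace I x)) (hb : g.IsOrthonormalFrame x b)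
    (hm : 3 ≤ Fintype.card ι) (i j k l : ι) : g.weylFrame x b i j k l = 0 := by
  have h3 : (3 : ℝ) ≤ Fintype.card ι := by exact_mod_cast hm
  have hm2 : (Fintype.card ι : ℝ) - 2 ≠ 0 := by linarith
  have hm1 : (Fintype.card ι : ℝ) - 1 ≠ 0 := by linarith
  rw [weylFrame_apply, h.curvatureForm_eq, h.ricci_frame_eq b hb, h.ricci_frame_eq b hb,
    h.ricci_frame_eq b hb, h.ricci_frame_eq b hb, h.scalarCurvature_eq_of_basis b hb]
  simp only [hb.val_eq_ite, frameDelta]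
  field_simp
  ring
/-- **`|W|² ≡ 0` for constant sectional curvature** on a model space of dimension `≥ 3`: every
orthonormal frame of size `dim E` is a basis with vanishing Weyl components
(`HasConstantSectionalCurvatureWith.weylFrame_eq_zero`), so the supremum defining `weylNormSq`
is `0` (`weylNormSq_eq_zero`). [cite: Besse1987, 1.118–1.119] -/
theorem _root_.Literature.Geometry.Lorentzian.PseudoRiemannianMetric.HasConstantSectionalCurvatureWith.weylNormSq_eq_zero
    {c : ℝ} (h : g.HasConstantSectionalCurvatureWith g.leviCivita c) (hE : 3 ≤ finrank ℝ E) (x : M) :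
    g.weylNormSq x = 0 := by
  refine g.weylNormSq_eq_zero x fun e he i j k l ↦ ?_
  have hι : Fintype.card (Fin (finrank ℝ E)) = finrank ℝ E := Fintype.card_fin _
  have hb : g.IsOrthonormalFrame x ⇑(he.toBasis hι) := by rw [he.coe_toBasis hι]; exact he
  have h0 := h.weylFrame_eq_zero (he.toBasis hι) hb (by rwa [Fintype.card_fin]) i j k l
  rwa [he.coe_toBasis hι] at h0

/-- **Zero Weyl energy for constant sectional curvature**: `∫_M |W_g|² dV_g = 0` for a metric of
constant sectional curvature (with its Levi-Civita connection) on a Hausdorff manifold modelled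
on a space of dimension `≥ 3` — e.g. round spheres and their quotients, flat tori, hyperbolic
manifolds; in particular such metrics satisfy hypothesis (ii) `∫|W|² dV < 16π² χ(M)` of
Chang–Gursky–Yang's Thm. A whenever `χ(M) > 0`. [cite: Besse1987, 1.118–1.119]
[cite: ChangGurskyYang2003, Thm. A] -/
theorem _root_.Literature.Geometry.Lorentzian.PseudoRiemannianMetric.HasConstantSectionalCurvatureWith.weylEnergy_eq_zero
    [T2Space M] {c : ℝ} (h : g.HasConstantSectionalCurvatureWith g.leviCivita c)
    (hE : 3 ≤ finrank ℝ E) : g.weylEnergy = 0 :=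
  g.weylEnergy_eq_zero_of_weylNormSq_eq_zero fun x ↦ h.weylNormSq_eq_zero hE x

/-- The same for `HasConstantSectionalCurvature` (constant curvature for every Levi-Civita
connection of `g`; `g.leviCivita` is one, `isLeviCivita_leviCivita_holds`).
[cite: Besse1987, 1.118–1.119] -/
theorem _root_.Literature.Geometry.Lorentzian.PseudoRiemannianMetric.HasConstantSectionalCurvature.weylEnergy_eq_zero
    [T2Space M] [CompleteSpace E] [Fact (1 ≤ n)] {c : ℝ} (h : g.HasConstantSectionalCurvature c)
    (hE : 3 ≤ finrank ℝ E) : g.weylEnergy = 0 :=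
  (h.with g.isLeviCivita_leviCivita_holds).weylEnergy_eq_zero hE

/-- **The trace-free Ricci tensor of a constant-curvature pair vanishes** in an orthonormal basis:
`E = Ric - (S/m) δ = (m-1)c δ - (m-1)c δ = 0`. [cite: Lee2018, Prop. 8.36] -/
theorem _root_.Literature.Geometry.Lorentzian.PseudoRiemannianMetric.HasConstantSectionalCurvatureWith.tracelessRicciFrame_eq_zero
    {c : ℝ} (h : g.HasConstantSectionalCurvatureWith g.leviCivita c) {x : M} {ι : Type*} [Fintype ι]
    [DecidableEq ι] (b : Basis ι ℝ (TangentSpace I x)) (hb : g.IsOrthonormalFrame x b) (a a' : ι) :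
    g.tracelessRicciFrame x b a a' = 0 := by
  haveI : Nonempty ι := ⟨a⟩
  have hcard : (Fintype.card ι : ℝ) ≠ 0 := by exact_mod_cast Fintype.card_ne_zero
  rw [tracelessRicciFrame_apply, h.ricci_frame_eq b hb, h.scalarCurvature_eq_of_basis b hb]
  field_simp
  ring

/-- **`Z ≡ 0` for constant sectional curvature** (Chang–Gursky–Yang 2003, p. 106: "`(M⁴, g)`
has constant curvature if, and only if, `Z ≡ 0`" — the direction needing no Schur lemma): in an
orthonormal `4`-basis, `W = 0` and `E = 0`, so `Z = W + ½ E ⊙ δ = 0`.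
[cite: ChangGurskyYang2003, §0, p. 106] -/
theorem _root_.Literature.Geometry.Lorentzian.PseudoRiemannianMetric.HasConstantSectionalCurvatureWith.zFrame_eq_zero
    {c : ℝ} (h : g.HasConstantSectionalCurvatureWith g.leviCivita c) {x : M}
    (b : Basis (Fin 4) ℝ (TangentSpace I x)) (hb : g.IsOrthonormalFrame x b) (i j k l : Fin 4) :
    g.zFrame x b i j k l = 0 := by
  rw [zFrame, h.weylFrame_eq_zero b hb (by simp) i j k l, kulkarniNomizu]
  simp [h.tracelessRicciFrame_eq_zero b hb]

/-- **`|E|² ≡ 0` for constant sectional curvature** (model dimension `≥ 1`).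
[cite: ChangGurskyYang2003, §0, p. 106] -/
theorem _root_.Literature.Geometry.Lorentzian.PseudoRiemannianMetric.HasConstantSectionalCurvatureWith.tracelessRicciNormSq_eq_zero
    {c : ℝ} (h : g.HasConstantSectionalCurvatureWith g.leviCivita c) (x : M) :
    g.tracelessRicciNormSq x = 0 := by
  unfold tracelessRicciNormSq
  have : ∀ e : {e : Fin (finrank ℝ E) → TangentSpace I x // g.IsOrthonormalFrame x e},
      g.tracelessRicciNormSqFrame x e.1 = 0 := by
    rintro ⟨e, he⟩
    have hι : Fintype.card (Fin (finrank ℝ E)) = finrank ℝ E := Fintype.card_fin _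
    have hb : g.IsOrthonormalFrame x ⇑(he.toBasis hι) := by rw [he.coe_toBasis hι]; exact he
    have h0 := h.tracelessRicciFrame_eq_zero (he.toBasis hι) hb
    rw [he.coe_toBasis hι] at h0
    simp [tracelessRicciNormSqFrame, h0]
  simp [this]

/-- **`WP ≡ 0` for constant sectional curvature** on a model of dimension `≥ 3` (the round
sphere and its quotients: the case `WP = 0 < 1/6` of Margerin's theorem).
[cite: ChangGurskyYang2003, §0, p. 106] [cite: Margerin1998, Thm. 1] -/
theorem _root_.Literature.Geometry.Lorentzian.PseudoRiemannianMetric.HasConstantSectionalCurvatureWith.weakPinching_eq_zero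
    {c : ℝ} (h : g.HasConstantSectionalCurvatureWith g.leviCivita c) (hE : 3 ≤ finrank ℝ E) (x : M) :
    g.weakPinching x = 0 := by
  rw [weakPinching, h.weylNormSq_eq_zero hE x, h.tracelessRicciNormSq_eq_zero x]
  simp

end ConstantCurvature

/-! #### Constant rescaling `g ↦ c g`: the Levi-Civita connection, `Ric`, `S`, `W` and `|W|²` -/

section Scaling

open FiberBundle

variable {g}

omit [FiniteDimensional ℝ E] [g.HasLeviCivita] in
/-- **The Koszul functional is homogeneous of degree one in the metric**:
`K_{c g}(X,Y,Z) = c K_g(X,Y,Z)` (each of its six terms contains `g` exactly once; O'Neill 1983,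
Ch. 3, Thm. 3.11, Koszul formula). [cite: ONeill1983, Ch. 3, Thm. 3.11] -/
theorem _root_.Literature.Geometry.Lorentzian.PseudoRiemannianMetric.koszulFunctional_constSmul
    (c : ℝ) (hc : c ≠ 0) (X Y Z : Π x : M, TangentSpace I x) (x : M) :
    (g.constSmul c hc).koszulFunctional X Y Z x = c * g.koszulFunctional X Y Z x := by
  simp only [koszulFunctional, mvfderiv_const_mul, _root_.smul_apply, smul_eq_mul, constSmul_apply]
  ring

omit [FiniteDimensional ℝ E] [g.HasLeviCivita] in
/-- **The Levi-Civita connection is invariant under constant rescaling of the metric**, for the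
bundled Koszul construction `leviCivitaFun` of `LeviCivita.lean`: the defining condition
`2 (c g)(A X₀, Z₀) = K_{c g}` is `c` times the condition for `g` (`koszulFunctional_constSmul`),
so the two conditions have the same (unique, by nondegeneracy) solutions `A = (∇Y)_x`, and the
same junk value `0` when there is none. Topping 2006, §1.2.3 ("the connection also remains
invariant"); O'Neill 1983, Ch. 3, Thm. 3.11. [cite: Topping2006, §1.2.3]
[cite: ONeill1983, Ch. 3, Thm. 3.11] -/
theorem _root_.Literature.Geometry.Lorentzian.PseudoRiemannianMetric.leviCivitaFun_constSmul
    (c : ℝ) (hc : c ≠ 0) : (g.constSmul c hc).leviCivitaFun = g.leviCivitaFun := by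
  funext Y x
  -- the two defining conditions agree
  have hiff : ∀ A : TangentSpace I x →L[ℝ] TangentSpace I x,
      (∀ X₀ Z₀ : TangentSpace I x, 2 * (g.constSmul c hc).val x (A X₀) Z₀ =
        (g.constSmul c hc).koszulFunctional (extend E X₀) Y (extend E Z₀) x) ↔
      (∀ X₀ Z₀ : TangentSpace I x, 2 * g.val x (A X₀) Z₀ =
        g.koszulFunctional (extend E X₀) Y (extend E Z₀) x) := by
    intro A
    simp only [constSmul_apply, koszulFunctional_constSmul]
    refine ⟨fun h X₀ Z₀ ↦ ?_, fun h X₀ Z₀ ↦ ?_⟩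
    · have := h X₀ Z₀
      have h' : c * (2 * g.val x (A X₀) Z₀) = c * g.koszulFunctional (extend E X₀) Y (extend E Z₀) x := by
        linarith
      exact mul_left_cancel₀ hc h'
    · rw [mul_left_comm, h X₀ Z₀]
  -- solutions of the condition for `g` are unique
  have huniq : ∀ A B : TangentSpace I x →L[ℝ] TangentSpace I x,
      (∀ X₀ Z₀ : TangentSpace I x, 2 * g.val x (A X₀) Z₀ =
        g.koszulFunctional (extend E X₀) Y (extend E Z₀) x) →
      (∀ X₀ Z₀ : TangentSpace I x, 2 * g.val x (B X₀) Z₀ =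
        g.koszulFunctional (extend E X₀) Y (extend E Z₀) x) → A = B := by
    intro A B hA hB
    ext X₀
    refine sub_eq_zero.1 (g.nondegenerate x _ fun Z₀ ↦ ?_)
    have h := (hA X₀ Z₀).trans (hB X₀ Z₀).symm
    rw [map_sub, _root_.sub_apply, sub_eq_zero]
    linarith
  simp only [leviCivitaFun]
  split_ifs with h₁ h₂ h₂
  · exact huniq _ _ ((hiff _).1 h₁.choose_spec) h₂.choose_spec
  · exact absurd (h₁.imp fun A hA ↦ (hiff A).1 hA) h₂
  · exact absurd (h₂.imp fun A hA ↦ (hiff A).2 hA) h₁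
  · rfl

omit [FiniteDimensional ℝ E] in
/-- `c g` has a Levi-Civita connection in the sense of the standing hypothesis `HasLeviCivita`
as soon as `g` has (the Koszul functions coincide, `leviCivitaFun_constSmul`).
[cite: Topping2006, §1.2.3] -/
theorem _root_.Literature.Geometry.Lorentzian.PseudoRiemannianMetric.HasLeviCivita.constSmul
    (c : ℝ) (hc : c ≠ 0) : (g.constSmul c hc).HasLeviCivita :=
  ⟨by rw [leviCivitaFun_constSmul c hc]; exact Fact.out⟩

omit [FiniteDimensional ℝ E] in
/-- **`∇^{c g} = ∇^g`** for the bundled Levi-Civita connections (`leviCivita`).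
[cite: Topping2006, §1.2.3] -/
theorem _root_.Literature.Geometry.Lorentzian.PseudoRiemannianMetric.leviCivita_constSmul
    (c : ℝ) (hc : c ≠ 0) [(g.constSmul c hc).HasLeviCivita] :
    (g.constSmul c hc).leviCivita = g.leviCivita :=
  CovariantDerivative.ext (leviCivitaFun_constSmul c hc)

omit [FiniteDimensional ℝ E] in
/-- **`Ric(c g) = Ric(g)`** (the Ricci tensor of the Levi-Civita connection as a bilinear form;
Topping 2006, §1.2.3, (1.2.8)). [cite: Topping2006, §1.2.3] -/
theorem _root_.Literature.Geometry.Lorentzian.PseudoRiemannianMetric.ricci_constSmul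
    (c : ℝ) (hc : c ≠ 0) [(g.constSmul c hc).HasLeviCivita] (x : M) :
    (g.constSmul c hc).ricci x = g.ricci x := by
  rw [ricci, ricci, leviCivita_constSmul c hc]

variable [CompleteSpace E] [Fact (1 ≤ n)]

/-- **`S(c g) = c⁻¹ S(g)`** (Topping 2006, §1.2.3, (1.2.8): `R ↦ λ⁻¹ R` under `g ↦ λ g`).
[cite: Topping2006, §1.2.3] -/
theorem _root_.Literature.Geometry.Lorentzian.PseudoRiemannianMetric.scalarCurvature_constSmul
    (c : ℝ) (hc : c ≠ 0) [(g.constSmul c hc).HasLeviCivita] (x : M) :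
    (g.constSmul c hc).scalarCurvature x = c⁻¹ * g.scalarCurvature x := by
  rw [← scalarCurvatureWith_leviCivita, ← scalarCurvatureWith_leviCivita, leviCivita_constSmul c hc,
    scalarCurvatureWith_constSmul]

omit [FiniteDimensional ℝ E] [CompleteSpace E] [Fact (1 ≤ n)] in
/-- **`Rm_{c g} = c Rm_g`** for the covariant curvature tensors of the bundled Levi-Civita
connections. [cite: Topping2006, §1.2.3] -/
theorem _root_.Literature.Geometry.Lorentzian.PseudoRiemannianMetric.curvatureForm_leviCivita_constSmul
    (c : ℝ) (hc : c ≠ 0) [(g.constSmul c hc).HasLeviCivita] (x : M) (X Y Z W : TangentSpace I x) :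
    (g.constSmul c hc).curvatureForm (g.constSmul c hc).leviCivita x X Y Z W =
      c * g.curvatureForm g.leviCivita x X Y Z W := by
  rw [leviCivita_constSmul c hc, curvatureForm_constSmul]

/-- **The frame Weyl tensor under rescaling**: `W_{c g}(e) = c⁻¹ W_g(√c • e)` for every frame
`e` and `c > 0` (so that `(c g)`-orthonormal frames `e` correspond to `g`-orthonormal frames
`√c • e`, `isOrthonormalFrame_constSmul_iff`): `Rm`, `Ric`, `S` of `c g` on `e` are `c⁻¹` times
those of `g` on `√c • e`. This is the pointwise content of the scale invariance of the Weyl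
functional in dimension `4` (Chang–Gursky–Yang 2003, p. 106: `WP` "scale-invariant"; p. 109).
[cite: ChangGurskyYang2003, (0.2)–(0.3)] [cite: Topping2006, §1.2.3] -/
theorem _root_.Literature.Geometry.Lorentzian.PseudoRiemannianMetric.weylFrame_constSmul
    {c : ℝ} (hc : 0 < c) [(g.constSmul c hc.ne').HasLeviCivita] (x : M) {ι : Type*} [Fintype ι]
    [DecidableEq ι] (e : ι → TangentSpace I x) (i j k l : ι) :
    (g.constSmul c hc.ne').weylFrame x e i j k l =
      c⁻¹ * g.weylFrame x (Real.sqrt c • e) i j k l := by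
  have hcc : Real.sqrt c * Real.sqrt c = c := Real.mul_self_sqrt hc.le
  have hc4 : Real.sqrt c ^ 4 = c ^ 2 := by
    rw [show (4 : ℕ) = 2 * 2 from rfl, pow_mul, Real.sq_sqrt hc.le]
  rw [weylFrame_apply, weylFrame_apply, curvatureForm_leviCivita_constSmul c hc.ne',
    scalarCurvature_constSmul c hc.ne']
  simp only [ricci_constSmul c hc.ne', Pi.smul_apply, curvatureForm_smul_smul_smul_smul, hc4,
    map_smul, LinearMap.smul_apply, smul_eq_mul, ← mul_assoc, hcc]
  field_simp

/-- **`|W_{c g}|²(e) = c⁻² |W_g|²(√c • e)`** for the frame norm. [cite: ChangGurskyYang2003, (0.2)–(0.3)] -/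
theorem _root_.Literature.Geometry.Lorentzian.PseudoRiemannianMetric.weylNormSqFrame_constSmul
    {c : ℝ} (hc : 0 < c) [(g.constSmul c hc.ne').HasLeviCivita] (x : M) {ι : Type*} [Fintype ι]
    [DecidableEq ι] (e : ι → TangentSpace I x) :
    (g.constSmul c hc.ne').weylNormSqFrame x e = c⁻¹ ^ 2 * g.weylNormSqFrame x (Real.sqrt c • e) := by
  simp only [weylNormSqFrame, weylFrame_constSmul hc, mul_pow, Finset.mul_sum]

/-- **`|W_{c g}|² = c⁻² |W_g|²` pointwise** (`c > 0`): the squared norm of the Weyl tensor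
(`weylNormSq`, the integrand of the Weyl energy) scales by `c⁻²` under `g ↦ c g` — with the
volume scaling `dV_{c g} = c^{m/2} dV_g` this is the scale invariance of `∫|W|² dV` exactly in
dimension `m = 4` (Chang–Gursky–Yang 2003, p. 106 and (0.3)). If `T_x M` has a
`(c g)_x`-orthonormal frame `e`, then `√c • e` is `g_x`-orthonormal and both sides are frame values
(`weylNormSq_eq_weylNormSqFrame`, `weylNormSqFrame_constSmul`); otherwise neither metric has an
orthonormal frame at `x` and both sides are the junk value `0`. [cite: ChangGurskyYang2003, (0.3)]
[cite: Topping2006, §1.2.3] -/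
theorem _root_.Literature.Geometry.Lorentzian.PseudoRiemannianMetric.weylNormSq_constSmul
    {c : ℝ} (hc : 0 < c) [(g.constSmul c hc.ne').HasLeviCivita] (x : M) :
    (g.constSmul c hc.ne').weylNormSq x = c⁻¹ ^ 2 * g.weylNormSq x := by
  classical
  by_cases h : Nonempty {e : Fin (finrank ℝ E) → TangentSpace I x // (g.constSmul c hc.ne').IsOrthonormalFrame x e}
  · obtain ⟨⟨e, he⟩⟩ := h
    have he' : g.IsOrthonormalFrame x (Real.sqrt c • e) :=
      (isOrthonormalFrame_constSmul_iff hc x e).1 he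
    rw [(g.constSmul c hc.ne').weylNormSq_eq_weylNormSqFrame he, g.weylNormSq_eq_weylNormSqFrame he',
      weylNormSqFrame_constSmul hc]
  · -- no orthonormal frames for `c g`, hence none for `g`
    rw [not_nonempty_iff] at h
    have h' : IsEmpty {e : Fin (finrank ℝ E) → TangentSpace I x // g.IsOrthonormalFrame x e} := by
      refine ⟨fun ⟨e, he⟩ ↦ h.false ⟨(Real.sqrt c)⁻¹ • e, ?_⟩⟩
      rw [isOrthonormalFrame_constSmul_iff hc x, smul_smul,
        mul_inv_cancel₀ (Real.sqrt_pos.2 hc).ne', one_smul]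
      exact he
    unfold weylNormSq
    rw [Real.iSup_of_isEmpty, Real.iSup_of_isEmpty, mul_zero]

/-- **The frame trace-free Ricci tensor under rescaling**: `E_{c g}(e) = c⁻¹ E_g(√c • e)`
(`Ric` unchanged, `S ↦ c⁻¹ S`). [cite: ChangGurskyYang2003, (0.2)] [cite: Topping2006, §1.2.3] -/
theorem _root_.Literature.Geometry.Lorentzian.PseudoRiemannianMetric.tracelessRicciFrame_constSmul
    {c : ℝ} (hc : 0 < c) [(g.constSmul c hc.ne').HasLeviCivita] (x : M) {ι : Type*} [Fintype ι]
    [DecidableEq ι] (e : ι → TangentSpace I x) (a b : ι) :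
    (g.constSmul c hc.ne').tracelessRicciFrame x e a b =
      c⁻¹ * g.tracelessRicciFrame x (Real.sqrt c • e) a b := by
  have hcc : Real.sqrt c * Real.sqrt c = c := Real.mul_self_sqrt hc.le
  rw [tracelessRicciFrame_apply, tracelessRicciFrame_apply, scalarCurvature_constSmul c hc.ne']
  simp only [ricci_constSmul c hc.ne', Pi.smul_apply, map_smul, LinearMap.smul_apply, smul_eq_mul,
    ← mul_assoc, hcc]
  field_simp

/-- **`|E_{c g}|²(e) = c⁻² |E_g|²(√c • e)`** for the frame norm. [cite: ChangGurskyYang2003, (0.2)] -/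
theorem _root_.Literature.Geometry.Lorentzian.PseudoRiemannianMetric.tracelessRicciNormSqFrame_constSmul
    {c : ℝ} (hc : 0 < c) [(g.constSmul c hc.ne').HasLeviCivita] (x : M) {ι : Type*} [Fintype ι]
    [DecidableEq ι] (e : ι → TangentSpace I x) :
    (g.constSmul c hc.ne').tracelessRicciNormSqFrame x e =
      c⁻¹ ^ 2 * g.tracelessRicciNormSqFrame x (Real.sqrt c • e) := by
  simp only [tracelessRicciNormSqFrame, tracelessRicciFrame_constSmul hc, mul_pow, Finset.mul_sum]

/-- **`|E_{c g}|² = c⁻² |E_g|²` pointwise** (`c > 0`; junk `0` on both sides where there is no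
orthonormal frame). [cite: ChangGurskyYang2003, (0.2)] [cite: Topping2006, §1.2.3] -/
theorem _root_.Literature.Geometry.Lorentzian.PseudoRiemannianMetric.tracelessRicciNormSq_constSmul
    {c : ℝ} (hc : 0 < c) [(g.constSmul c hc.ne').HasLeviCivita] (x : M) :
    (g.constSmul c hc.ne').tracelessRicciNormSq x = c⁻¹ ^ 2 * g.tracelessRicciNormSq x := by
  classical
  by_cases h : Nonempty {e : Fin (finrank ℝ E) → TangentSpace I x // (g.constSmul c hc.ne').IsOrthonormalFrame x e}
  · obtain ⟨⟨e, he⟩⟩ := h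
    have he' : g.IsOrthonormalFrame x (Real.sqrt c • e) :=
      (isOrthonormalFrame_constSmul_iff hc x e).1 he
    rw [(g.constSmul c hc.ne').tracelessRicciNormSq_eq_tracelessRicciNormSqFrame he,
      g.tracelessRicciNormSq_eq_tracelessRicciNormSqFrame he', tracelessRicciNormSqFrame_constSmul hc]
  · rw [not_nonempty_iff] at h
    have h' : IsEmpty {e : Fin (finrank ℝ E) → TangentSpace I x // g.IsOrthonormalFrame x e} := by
      refine ⟨fun ⟨e, he⟩ ↦ h.false ⟨(Real.sqrt c)⁻¹ • e, ?_⟩⟩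
      rw [isOrthonormalFrame_constSmul_iff hc x, smul_smul,
        mul_inv_cancel₀ (Real.sqrt_pos.2 hc).ne', one_smul]
      exact he
    unfold tracelessRicciNormSq
    rw [Real.iSup_of_isEmpty, Real.iSup_of_isEmpty, mul_zero]

/-- **Weak pinching is scale invariant**: `WP_{c g} = WP_g` for `c > 0` (Chang–Gursky–Yang 2003,
(0.2): "the scale-invariant 'weak pinching' quantity"; Margerin 1998, p. 25: "normalized by the
scalar curvature to get a scale invariant"): numerator and denominator both scale by `c⁻²`.
[cite: ChangGurskyYang2003, (0.2)] [cite: Margerin1998, Part I, p. 25] -/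
theorem _root_.Literature.Geometry.Lorentzian.PseudoRiemannianMetric.weakPinching_constSmul
    {c : ℝ} (hc : 0 < c) [(g.constSmul c hc.ne').HasLeviCivita] (x : M) :
    (g.constSmul c hc.ne').weakPinching x = g.weakPinching x := by
  rw [weakPinching, weakPinching, weylNormSq_constSmul hc, tracelessRicciNormSq_constSmul hc,
    scalarCurvature_constSmul c hc.ne']
  by_cases hS : g.scalarCurvature x = 0
  · simp [hS]
  · have hc' : c⁻¹ ≠ 0 := inv_ne_zero hc.ne'
    field_simp

end Scaling

end PseudoRiemannianMetric

/-! ### The round sphere: constant curvature `1`, positive scalar curvature, zero Weyl energy -/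

section RoundSphere

open Literature.Geometry.Lorentzian (PseudoRiemannianMetric)
open Literature.Geometry.Lorentzian.PseudoRiemannianMetric
open Metric

variable (V : Type*) [NormedAddCommGroup V] [InnerProductSpace ℝ V] {m : ℕ}
  [Fact (finrank ℝ V = m + 1)]

/-- **The round unit sphere has constant sectional curvature `1`** (Lee 2018, Thm. 8.34 (b) with
Prop. 8.36), for every Levi-Civita connection of the round metric: the proved Gauss-equation
computation `R(X,Y)Z = g(Y,Z)X - g(X,Z)Y` (`curvature_roundMetric`, `RoundSphereProofs.lean`)
paired with a fourth vector. [cite: Lee2018, Thm. 8.34 (b) and Prop. 8.36] -/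
theorem hasConstantSectionalCurvatureWith_roundMetric
    {cov : CovariantDerivative (𝓡 m) (EuclideanSpace ℝ (Fin m))
      (TangentSpace (𝓡 m) : sphere (0 : V) 1 → Type _)}
    (h : (roundMetric (n := m) V).IsLeviCivita cov) :
    (roundMetric (n := m) V).HasConstantSectionalCurvatureWith cov 1 := by
  intro x X Y Z W
  rw [curvatureForm, curvature_roundMetric h x X Y Z, map_sub, map_smul, map_smul]
  simp only [_root_.sub_apply, _root_.smul_apply, smul_eq_mul]
  ring

/-- Hence the round unit sphere has constant sectional curvature `1` in the sense of
`HasConstantSectionalCurvature`. [cite: Lee2018, Thm. 8.34 (b) and Prop. 8.36] -/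
theorem hasConstantSectionalCurvature_roundMetric :
    (roundMetric (n := m) V).HasConstantSectionalCurvature 1 :=
  fun _ h ↦ hasConstantSectionalCurvatureWith_roundMetric V h

/-- **The round sphere `Sᵐ`, `m ≥ 3`, has zero Weyl energy**: `∫_{Sᵐ} |W|² dV = 0` for the round
metric and its Levi-Civita connection (conformal flatness of the round sphere at the level of the
Weyl tensor; for `m = 4` this is the model case `∫|W|² = 0 < 32π² = 16π² χ(S⁴)` of
Chang–Gursky–Yang's Thm. A). [cite: Besse1987, 1.118–1.119] [cite: ChangGurskyYang2003, Thm. A] -/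
theorem weylEnergy_roundMetric_eq_zero [(roundMetric (n := m) V).HasLeviCivita] (hm : 3 ≤ m) :
    (roundMetric (n := m) V).weylEnergy = 0 :=
  (hasConstantSectionalCurvature_roundMetric V).weylEnergy_eq_zero
    (by rwa [finrank_euclideanSpace_fin])

/-- **The round sphere `Sᵐ` has scalar curvature `m(m-1)`** (for the Levi-Civita connection
`leviCivita` of the round metric; Lee 2018, Prop. 8.36: `S = n(n-1)c`), in particular positive
scalar curvature for `m ≥ 2`. [cite: Lee2018, Prop. 8.36] -/
theorem scalarCurvature_roundMetric [(roundMetric (n := m) V).HasLeviCivita] (x : sphere (0 : V) 1) :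
    (roundMetric (n := m) V).scalarCurvature x = (m : ℝ) * ((m : ℝ) - 1) := by
  classical
  have hpos := isRiemannian_roundMetric (n := m) (V := V) x
  obtain ⟨b, hb⟩ := (roundMetric (n := m) V).exists_basis_isOrthonormalFrame (x := x) hpos
    (finrank_euclideanSpace_fin (𝕜 := ℝ) (n := m))
  have h := (hasConstantSectionalCurvatureWith_roundMetric V
    (roundMetric (n := m) V).isLeviCivita_leviCivita_holds).scalarCurvature_eq_of_basis b hb
  simpa using h

/-- Positive scalar curvature of the round sphere `Sᵐ`, `m ≥ 2`. [cite: Lee2018, Prop. 8.36] -/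
theorem scalarCurvature_roundMetric_pos [(roundMetric (n := m) V).HasLeviCivita] (hm : 2 ≤ m)
    (x : sphere (0 : V) 1) : 0 < (roundMetric (n := m) V).scalarCurvature x := by
  rw [scalarCurvature_roundMetric V x]
  have h2 : (2 : ℝ) ≤ m := by exact_mod_cast hm
  nlinarith

/-- **The round `S⁴` satisfies the hypotheses of `changGurskyYang_sphere_four`** (non-vacuity of
the vended fact's antecedent with the tree's definitions): on the unit sphere of a
`5`-dimensional inner product space the round metric is a `C^∞` Riemannian metric with
Levi-Civita connection, scalar curvature `12 > 0` and Weyl energy `0 < 32π²` (Chang–Gursky–Yang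
2003, p. 106: the round sphere is the model of Thm. A; here `∫|W|² = 0 < 16π² χ(S⁴) = 32π²`).
[cite: ChangGurskyYang2003, Thm. A] -/
theorem roundSphere_four_changGurskyYang_hypotheses (V : Type*) [NormedAddCommGroup V]
    [InnerProductSpace ℝ V] [Fact (finrank ℝ V = 4 + 1)] :
    ∃ g : PseudoRiemannianMetric (𝓡 4) ∞ (EuclideanSpace ℝ (Fin 4))
        (TangentSpace (𝓡 4) : sphere (0 : V) 1 → Type _),
      ∃ _ : g.HasLeviCivita, g.IsRiemannian ∧ (∀ x, 0 < g.scalarCurvature x) ∧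
        g.weylEnergy < ENNReal.ofReal (32 * Real.pi ^ 2) := by
  haveI : (roundMetric (n := 4) V).HasLeviCivita := (roundMetric (n := 4) V).hasLeviCivita
  refine ⟨roundMetric (n := 4) V, ‹_›, isRiemannian_roundMetric, fun x ↦
    scalarCurvature_roundMetric_pos V (by norm_num) x, ?_⟩
  rw [weylEnergy_roundMetric_eq_zero V (by norm_num)]
  exact ENNReal.ofReal_pos.2 (by positivity)

end RoundSphere

/-! ### Finiteness of the Weyl energy on closed manifolds -/

section Finiteness

open Literature.Geometry.Lorentzian (PseudoRiemannianMetric riemannianMeasure)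
open Literature.Geometry.Lorentzian.PseudoRiemannianMetric
open MeasureTheory

variable {E : Type*} [NormedAddCommGroup E] [NormedSpace ℝ E] {H : Type*} [TopologicalSpace H]
  {I : ModelWithCorners ℝ E H} {M : Type*} [TopologicalSpace M] [ChartedSpace H M]
  [IsManifold I ∞ M]

/-- **`|W|²` as a polynomial in the frame curvature components** `r_{abcd} = Rm(e_a,e_b,e_c,e_d)`
of an orthonormal basis `e` of size `m = |ι|` (with `Ric_{ab} = Σᵢ r_{iabi}`, `S = Σ_a Ric_{aa}`
substituted into `weylFrame`): the continuous function of the curvature array to which the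
compactness lemma `exists_pos_le_curvatureFunctional` (`OrthonormalFrameBounds.lean`) applies.
[cite: Besse1987, (1.116)] -/
def weylNormSqPoly (ι : Type*) [Fintype ι] [DecidableEq ι] (r : ι → ι → ι → ι → ℝ) : ℝ :=
  ∑ i, ∑ j, ∑ k, ∑ l,
    (r i j k l -
      1 / ((Fintype.card ι : ℝ) - 2) *
        ((∑ p, r p i l p) * (if j = k then 1 else 0) + (∑ p, r p j k p) * (if i = l then 1 else 0) -
          (∑ p, r p i k p) * (if j = l then 1 else 0) - (∑ p, r p j l p) * (if i = k then 1 else 0)) +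
      (∑ a, ∑ p, r p a a p) / (((Fintype.card ι : ℝ) - 1) * ((Fintype.card ι : ℝ) - 2)) *
        ((if i = l then 1 else 0) * (if j = k then 1 else 0) -
          (if i = k then 1 else 0) * (if j = l then 1 else 0))) ^ 2

/-- `weylNormSqPoly` is continuous in the curvature array. [folklore] -/
theorem continuous_weylNormSqPoly (ι : Type*) [Fintype ι] [DecidableEq ι] :
    Continuous (weylNormSqPoly ι) := by
  unfold weylNormSqPoly
  fun_prop

variable (g : PseudoRiemannianMetric I ∞ E (TangentSpace I : M → Type _))
variable [FiniteDimensional ℝ E] [g.HasLeviCivita]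

/-- In a frame computing the Ricci contraction and the scalar curvature, `Σ W_{ijkl}²` is
`weylNormSqPoly` of the frame curvature components. [cite: Besse1987, (1.116)] -/
theorem _root_.Literature.Geometry.Lorentzian.PseudoRiemannianMetric.weylNormSqFrame_eq_weylNormSqPoly
    (x : M) {ι : Type*} [Fintype ι] [DecidableEq ι] (e : ι → TangentSpace I x)
    (hRic : ∀ a b, ∑ i, g.curvatureForm g.leviCivita x (e i) (e a) (e b) (e i) = g.ricci x (e a) (e b))
    (hS : ∑ i, g.ricci x (e i) (e i) = g.scalarCurvature x) :
    g.weylNormSqFrame x e =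
      weylNormSqPoly ι (fun a b c d ↦ g.curvatureForm g.leviCivita x (e a) (e b) (e c) (e d)) := by
  simp only [weylNormSqFrame, weylFrame_apply, weylNormSqPoly, ← hS, ← hRic]

/-- **`|W|²` is bounded on a closed Riemannian manifold**: for a `C^∞` Riemannian metric (with its
Levi-Civita connection) on a compact Hausdorff manifold there is `C` with `|W_g|²(x) ≤ C` for all
`x`. Proof: `|W|²(x)` is the value of the continuous function `weylNormSqPoly` on the curvature
components of any orthonormal basis at `x` (`weylNormSq_eq_weylNormSqFrame`,
`weylNormSqFrame_eq_weylNormSqPoly`), and the positive continuous functional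
`1/(1 + |weylNormSqPoly|)` is uniformly bounded below on orthonormal frames of a compact manifold
(`exists_pos_le_curvatureFunctional`, `OrthonormalFrameBounds.lean`). [folklore] -/
theorem _root_.Literature.Geometry.Lorentzian.PseudoRiemannianMetric.exists_weylNormSq_le
    [T2Space M] [CompactSpace M] [CompleteSpace E] (hg : g.IsRiemannian) :
    ∃ C : ℝ, ∀ x : M, g.weylNormSq x ≤ C := by
  classical
  haveI : LocallyCompactSpace M := Manifold.locallyCompact_of_finiteDimensional I
  set P := weylNormSqPoly (Fin (finrank ℝ E)) with hP
  set F : (Fin (finrank ℝ E) → Fin (finrank ℝ E) → Fin (finrank ℝ E) → Fin (finrank ℝ E) → ℝ) →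
      Unit → ℝ := fun r _ ↦ 1 / (1 + |P r|) with hF
  have hFcont : ContinuousOn (Function.uncurry F) (Set.univ ×ˢ (Set.univ : Set Unit)) := by
    refine Continuous.continuousOn ?_
    have hc : Continuous P := continuous_weylNormSqPoly _
    refine Continuous.div continuous_const (continuous_const.add (hc.comp continuous_fst).abs) ?_
    intro r
    have : 0 ≤ |P r.1| := abs_nonneg _
    exact ne_of_gt (by linarith)
  have hFpos : ∀ (x : M) (e : Fin (finrank ℝ E) → TangentSpace I x), g.IsOrthonormalFrame x e →
      ∀ y ∈ (Set.univ : Set Unit),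
        0 < F (fun a b c d ↦ g.curvatureForm g.leviCivita x (e a) (e b) (e c) (e d)) y := by
    intro x e _ y _
    simp only [hF]
    positivity
  obtain ⟨m, hm, hle⟩ := exists_pos_le_curvatureFunctional hg g.isLeviCivita_leviCivita_holds
    isCompact_univ hFcont hFpos
  refine ⟨1 / m, fun x ↦ ?_⟩
  obtain ⟨b, hb⟩ := g.exists_basis_isOrthonormalFrame (x := x) (fun v hv ↦ hg x v hv) rfl
  have h1 := hle x b hb () (Set.mem_univ _)
  simp only [hF] at h1
  set r := fun a b' c d ↦ g.curvatureForm g.leviCivita x (b a) (b b') (b c) (b d) with hr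
  have hPr : g.weylNormSq x = P r := by
    rw [g.weylNormSq_eq_weylNormSqFrame hb, hP,
      g.weylNormSqFrame_eq_weylNormSqPoly x b
        (fun a c ↦ (g.ricci_eq_sum_of_isOrthonormalFrame b hb g.leviCivita (b a) (b c)).symm)
        (by rw [scalarCurvature, g.trace_eq_sum_of_isOrthonormalFrame b hb (g.ricci x)])]
  have hpos : 0 < 1 + |P r| := by positivity
  rw [hPr]
  calc P r ≤ |P r| := le_abs_self _
    _ ≤ 1 + |P r| - 1 := by ring_nf; rfl
    _ ≤ 1 / m - 1 := by
        have : 1 + |P r| ≤ 1 / m := by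
          rw [le_div_iff₀ hm]
          calc (1 + |P r|) * m ≤ (1 + |P r|) * (1 / (1 + |P r|)) := by gcongr
            _ = 1 := by field_simp
        linarith
    _ ≤ 1 / m := by linarith

/-- **The Weyl energy of a closed Riemannian manifold is finite**: `∫_M |W_g|² dV_g < ∞` for a
`C^∞` Riemannian metric on a compact Hausdorff manifold (the finiteness deferred in
`WeylEnergy.lean`: `|W|²` is bounded, `exists_weylNormSq_le`, and the Riemannian volume of a
compact manifold is finite, `riemannianVolume_lt_top_of_isCompact_holds`). This is what makes the
hypothesis `∫|W|² dV < 16π² χ(M)` of Chang–Gursky–Yang's Thm. A (here `< 32π²`) a condition on a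
real number. [cite: ChangGurskyYang2003, Thm. A, (0.3)] -/
theorem _root_.Literature.Geometry.Lorentzian.PseudoRiemannianMetric.weylEnergy_lt_top
    [T2Space M] [CompactSpace M] [CompleteSpace E] (hg : g.IsRiemannian) : g.weylEnergy < ⊤ := by
  haveI : LocallyCompactSpace M := Manifold.locallyCompact_of_finiteDimensional I
  letI : MeasurableSpace M := borel M
  haveI : BorelSpace M := ⟨rfl⟩
  obtain ⟨C, hC⟩ := g.exists_weylNormSq_le hg
  rw [g.weylEnergy_eq hg]
  have hvol : riemannianMeasure (g.toContMDiffRiemannianMetric hg) Set.univ < ⊤ :=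
    Lorentzian.riemannianVolume_lt_top_of_isCompact_holds (g.toContMDiffRiemannianMetric hg) le_rfl
      isCompact_univ
  calc ∫⁻ x, ENNReal.ofReal (g.weylNormSq x) ∂(riemannianMeasure (g.toContMDiffRiemannianMetric hg))
      ≤ ∫⁻ _x, ENNReal.ofReal C ∂(riemannianMeasure (g.toContMDiffRiemannianMetric hg)) :=
        lintegral_mono fun x ↦ ENNReal.ofReal_le_ofReal (hC x)
    _ = ENNReal.ofReal C * riemannianMeasure (g.toContMDiffRiemannianMetric hg) Set.univ :=
        lintegral_const _
    _ < ⊤ := ENNReal.mul_lt_top ENNReal.ofReal_lt_top hvol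

end Finiteness

/-! ### §2: Theorem A (vended special case) from Theorem 1.4 and Margerin's theorem -/

section Reduction

open Literature.Geometry.Lorentzian (PseudoRiemannianMetric)
open Literature.Geometry.Lorentzian.PseudoRiemannianMetric
open Literature.Topology.FourManifolds

/-- **Chang–Gursky–Yang 2003, §2 (p. 121): the proof of Theorem A, as a reduction of the vended
fact `changGurskyYang_sphere_four` to its two analytic inputs.**

* `hMargerin` — MARGERIN'S WEAK-PINCHING SPHERE THEOREM (Margerin 1998, Thm. 1, with the weak
  pinching `WP = |W + ½ z ⊙ g|²/scal²` of Part I, p. 25, for metrics of positive scalar curvature,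
  Prop. 4; as quoted by Chang–Gursky–Yang 2003, p. 106: "if `R > 0` and `WP < 1/6`, then `M⁴` is
  diffeomorphic to either `S⁴` or `ℝP⁴`", `WP = (|W|² + 2|E|²)/R²` by (0.2)): for every closed
  connected smooth `4`-manifold `M` with a `C^∞` Riemannian metric of positive scalar curvature
  such that `|W|² + 2|E|² < S²/6` in every orthonormal frame at every point, `M` is diffeomorphic
  to the standard `S⁴` or is a standard real projective `4`-space
  (`Literature.Topology.FourManifolds.IsRealProjectiveSpace 4 M`; Margerin: "diffeomorphic to the
  (standard) 4-sphere, if it is orientable, or else to the standard `ℤ₂`-quotient").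
* `hPointwise` — THE CONCLUSION OF §1 UNDER THE HYPOTHESES OF THE VENDED SPECIAL CASE
  (Chang–Gursky–Yang 2003, §2, first six lines, with Thm. 1.4 for `α = 1`: assumption (0.3) is
  equivalent, by the Chern–Gauss–Bonnet formula (1.1), to (1.2) `∫σ₂(A) - ¼∫|W|² > 0`, and then
  "there is a conformal metric satisfying `σ₂(A) - ¼|W|² > 0`"; in the special case the inputs
  `Y(M,[g]) > 0` and (0.3) come from `scal_g > 0` and `∫|W|² < 32π² ≤ 16π² χ(M)`, `χ(M) ≥ 2` for
  closed simply connected `M`): for every closed simply connected smooth `4`-manifold with a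
  `C^∞` Riemannian metric `g` of positive scalar curvature and Weyl energy `< 32π²` there is a
  `C^∞` Riemannian metric `g'` on `M` of positive scalar curvature with `σ₂(A_{g'}) - ¼|W_{g'}|² > 0`
  in every orthonormal frame at every point (conformality of `g'` to `g`, part of Thm. 1.4, is not
  used in §2 and not required here; positivity of the scalar curvature of `g'`, implicit on p. 108
  — "this implies in particular that `R > 0`" — holds for the metrics of [CGY1] by construction).

Conclusion: `changGurskyYang_sphere_four`. Proof as printed: `σ₂(A) - ¼|W|² > 0` is
`|W|² + 2|E|² < S²/6` (`IsOrthonormalFrame.weakPinching_of_sigma2_sub_pos`: the algebra (0.2),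
`σ₂(A) = -½|E|² + R²/24`, "rearranging terms"), Margerin's theorem gives `S⁴` or `ℝP⁴`, and
`π₁(ℝP⁴) ≠ 1` (`IsRealProjectiveSpace.not_simplyConnectedSpace`) leaves `S⁴` for simply connected
`M`. Neither hypothesis is a named fact of the tree; both are deep theorems (Ricci flow; fully
nonlinear elliptic PDE and Chern–Gauss–Bonnet) recorded here as the exact remaining proof debt of
`changGurskyYang_sphere_four`. [cite: ChangGurskyYang2003, §2, p. 121]
[cite: Margerin1998, Thm. 1] -/
theorem changGurskyYang_sphere_four_of_margerin_of_pointwisePinching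
    (hMargerin : ∀ (M : Type) [TopologicalSpace M] [T2Space M] [SecondCountableTopology M]
      [ChartedSpace (EuclideanSpace ℝ (Fin 4)) M] [IsManifold (𝓡 4) ∞ M] [CompactSpace M]
      [ConnectedSpace M]
      (g : PseudoRiemannianMetric (𝓡 4) ∞ (EuclideanSpace ℝ (Fin 4)) (TangentSpace (𝓡 4) : M → Type _))
      [g.HasLeviCivita], g.IsRiemannian → (∀ x, 0 < g.scalarCurvature x) →
      (∀ (x : M) (e : Fin 4 → TangentSpace (𝓡 4) x), g.IsOrthonormalFrame x e →
        g.weylNormSqFrame x e + 2 * g.tracelessRicciNormSqFrame x e < g.scalarCurvature x ^ 2 / 6) →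
      Nonempty (M ≃ₘ⟮𝓡 4, 𝓡 4⟯ Metric.sphere (0 : EuclideanSpace ℝ (Fin 5)) 1) ∨
        IsRealProjectiveSpace 4 M)
    (hPointwise : ∀ (M : Type) [TopologicalSpace M] [T2Space M] [SecondCountableTopology M]
      [ChartedSpace (EuclideanSpace ℝ (Fin 4)) M] [IsManifold (𝓡 4) ∞ M] [CompactSpace M]
      [SimplyConnectedSpace M]
      (g : PseudoRiemannianMetric (𝓡 4) ∞ (EuclideanSpace ℝ (Fin 4)) (TangentSpace (𝓡 4) : M → Type _))
      [g.HasLeviCivita], g.IsRiemannian → (∀ x, 0 < g.scalarCurvature x) →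
      g.weylEnergy < ENNReal.ofReal (32 * Real.pi ^ 2) →
      ∃ (g' : PseudoRiemannianMetric (𝓡 4) ∞ (EuclideanSpace ℝ (Fin 4)) (TangentSpace (𝓡 4) : M → Type _))
        (_ : g'.HasLeviCivita), g'.IsRiemannian ∧ (∀ x, 0 < g'.scalarCurvature x) ∧
        ∀ (x : M) (e : Fin 4 → TangentSpace (𝓡 4) x), g'.IsOrthonormalFrame x e →
          1 / 4 * g'.weylNormSqFrame x e < g'.sigma2WeylSchoutenFrame x e) :
    changGurskyYang_sphere_four := by
  intro M _ _ _ _ _ _ _ hg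
  obtain ⟨g, _, hgR, hscal, hW⟩ := hg
  -- §1 (Thm. 1.4, α = 1): a metric with `σ₂(A) - ¼|W|² > 0` pointwise
  obtain ⟨g', _, hg'R, hscal', hpt⟩ := hPointwise M g hgR hscal hW
  -- "Rearranging terms": weak pinching `|W|² + 2|E|² < S²/6` in every orthonormal frame
  have hE : finrank ℝ (EuclideanSpace ℝ (Fin 4)) = 4 := finrank_euclideanSpace_fin
  have hpinch : ∀ (x : M) (e : Fin 4 → TangentSpace (𝓡 4) x), g'.IsOrthonormalFrame x e →
      g'.weylNormSqFrame x e + 2 * g'.tracelessRicciNormSqFrame x e < g'.scalarCurvature x ^ 2 / 6 :=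
    fun x e he ↦ he.weakPinching_of_sigma2_sub_pos g' (WithTop.coe_le_coe.mpr le_top) hE (hpt x e he)
  -- Margerin: `S⁴` or `ℝP⁴` (`M` is connected, being simply connected); `π₁ = 1` excludes `ℝP⁴`
  rcases hMargerin M g' hg'R hscal' hpinch with h | h
  · exact h
  · exact absurd ‹SimplyConnectedSpace M› (h.not_simplyConnectedSpace (by norm_num))

end Reduction

/-! ### `σ₂(A)` as a function on `M`, the integral `∫ σ₂(A) dV`, and pointwise (2.1) ⇒ `WP < 1/6` -/

section Sigma2

open MeasureTheory
open Literature.Geometry.Lorentzian (PseudoRiemannianMetric riemannianMeasure)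
open Literature.Geometry.Lorentzian.PseudoRiemannianMetric

variable {E : Type*} [NormedAddCommGroup E] [NormedSpace ℝ E] {H : Type*} [TopologicalSpace H]
  {I : ModelWithCorners ℝ E H} {M : Type*} [TopologicalSpace M] [ChartedSpace H M]
  [IsManifold I ∞ M] {n : ℕ∞ω}
  (g : PseudoRiemannianMetric I n E (TangentSpace I : M → Type _))
  [FiniteDimensional ℝ E] [g.HasLeviCivita]

/-- Reindexing a frame along an equivalence permutes the components of `A = Ric - (R/6) g`.
[folklore] -/
theorem _root_.Literature.Geometry.Lorentzian.PseudoRiemannianMetric.weylSchoutenFrame_comp_equiv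
    (x : M) {ι κ : Type*} [Fintype ι] [Fintype κ] [DecidableEq ι] [DecidableEq κ] (σ : ι ≃ κ)
    (e : κ → TangentSpace I x) (a b : ι) :
    g.weylSchoutenFrame x (e ∘ σ) a b = g.weylSchoutenFrame x e (σ a) (σ b) := by
  simp only [weylSchoutenFrame, Function.comp_apply, frameDelta, σ.injective.eq_iff]

/-- Reindexing a frame along an equivalence does not change `σ₂(A) = ½((tr A)² - tr A²)`.
[folklore] -/
theorem _root_.Literature.Geometry.Lorentzian.PseudoRiemannianMetric.sigma2WeylSchoutenFrame_comp_equiv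
    (x : M) {ι κ : Type*} [Fintype ι] [Fintype κ] [DecidableEq ι] [DecidableEq κ] (σ : ι ≃ κ)
    (e : κ → TangentSpace I x) :
    g.sigma2WeylSchoutenFrame x (e ∘ σ) = g.sigma2WeylSchoutenFrame x e := by
  have h1 : ∑ a, g.weylSchoutenFrame x (e ∘ σ) a a = ∑ a, g.weylSchoutenFrame x e a a :=
    Fintype.sum_equiv σ _ _ fun a ↦ g.weylSchoutenFrame_comp_equiv x σ e a a
  have h2 : ∑ a, ∑ b, g.weylSchoutenFrame x (e ∘ σ) a b * g.weylSchoutenFrame x (e ∘ σ) b a =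
      ∑ a, ∑ b, g.weylSchoutenFrame x e a b * g.weylSchoutenFrame x e b a :=
    Fintype.sum_equiv σ _ _ fun a ↦ Fintype.sum_equiv σ _ _ fun b ↦ by
      rw [g.weylSchoutenFrame_comp_equiv x σ e, g.weylSchoutenFrame_comp_equiv x σ e]
  rw [sigma2WeylSchoutenFrame, sigma2WeylSchoutenFrame, h1, h2]

/-- **`σ₂(A_g)(x)`, the second elementary symmetric function of the eigenvalues of the
Weyl–Schouten endomorphism `g⁻¹A`, `A = Ric - (1/6) R g`, as a function on `M`** (Chang–Gursky–Yang
2003, §1, (1.0) and p. 111: "at each point of `M⁴`, `g⁻¹A` has `4` real eigenvalues, thus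
`σ_k(g⁻¹A)` is a smooth function on `M⁴` … we denote `σ_k(A) = σ_k(g⁻¹A)`"): the value of the frame
expression `½((tr A)² - tr A²)` (`sigma2WeylSchoutenFrame`) on any `g_x`-orthonormal basis
`e : Fin (dim E) → T_x M` — frame independent in dimension `4`
(`sigma2WeylSchouten_eq_sigma2WeylSchoutenFrame`), so defined, exactly as `weylNormSq` and
`tracelessRicciNormSq`, as the supremum over the (possibly empty) type of orthonormal frames; junk
value `0` where `g_x` has no orthonormal basis. [cite: ChangGurskyYang2003, §1, (1.0)–(1.1)] -/
def _root_.Literature.Geometry.Lorentzian.PseudoRiemannianMetric.sigma2WeylSchouten (x : M) : ℝ :=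
  ⨆ e : {e : Fin (finrank ℝ E) → TangentSpace I x // g.IsOrthonormalFrame x e},
    g.sigma2WeylSchoutenFrame x e.1

/-- **`σ₂(A_g)(x)` is the frame value** `½((tr A)² - tr A²)` on every orthonormal `4`-frame of a
`C²` metric on a `4`-dimensional model (frame independence: by `σ₂(A) = -½|E|² + R²/24` in each
orthonormal frame, `sigma2WeylSchoutenFrame_eq_of_isOrthonormalFrame`, and the frame independence
of `|E|²`, `tracelessRicciNormSq_eq_tracelessRicciNormSqFrame_four`).
[cite: ChangGurskyYang2003, §1, (1.0)–(1.1)] -/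
theorem _root_.Literature.Geometry.Lorentzian.PseudoRiemannianMetric.sigma2WeylSchouten_eq_sigma2WeylSchoutenFrame
    [CompleteSpace E] [Fact (1 ≤ n)] (hn : 2 ≤ n) (hE : finrank ℝ E = 4) {x : M} {e : Fin 4 → TangentSpace I x}
    (he : g.IsOrthonormalFrame x e) :
    g.sigma2WeylSchouten x = g.sigma2WeylSchoutenFrame x e := by
  set σ : Fin (finrank ℝ E) ≃ Fin 4 := finCongr hE
  have hval : ∀ f : Fin (finrank ℝ E) → TangentSpace I x, g.IsOrthonormalFrame x f →
      g.sigma2WeylSchoutenFrame x f =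
        -(1 / 2) * g.tracelessRicciNormSq x + g.scalarCurvature x ^ 2 / 24 := by
    intro f hf
    have hf' : g.IsOrthonormalFrame x (f ∘ σ.symm) := hf.comp σ.symm.injective
    have hff : f = (f ∘ σ.symm) ∘ σ := by
      ext i
      simp
    rw [hff, g.sigma2WeylSchoutenFrame_comp_equiv x σ (f ∘ ⇑σ.symm),
      g.sigma2WeylSchoutenFrame_eq_of_isOrthonormalFrame hn hE hf',
      g.tracelessRicciNormSq_eq_tracelessRicciNormSqFrame_four hE hf']
  haveI : Nonempty {e : Fin (finrank ℝ E) → TangentSpace I x // g.IsOrthonormalFrame x e} :=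
    ⟨⟨e ∘ σ, he.comp σ.injective⟩⟩
  have hconst : (fun e' : {e : Fin (finrank ℝ E) → TangentSpace I x // g.IsOrthonormalFrame x e} ↦
      g.sigma2WeylSchoutenFrame x e'.1) =
      fun _ ↦ -(1 / 2) * g.tracelessRicciNormSq x + g.scalarCurvature x ^ 2 / 24 :=
    funext fun e' ↦ hval e'.1 e'.2
  unfold sigma2WeylSchouten
  rw [hconst, ciSup_const, g.sigma2WeylSchoutenFrame_eq_of_isOrthonormalFrame hn hE he,
    g.tracelessRicciNormSq_eq_tracelessRicciNormSqFrame_four hE he]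

/-- **`σ₂(A) = -½|E|² + R²/24` pointwise** (Chang–Gursky–Yang 2003, §2, p. 121; (0.4) versus
(1.1)), for a `C²` metric on a `4`-dimensional model, at every point where `g_x` is positive
definite. [cite: ChangGurskyYang2003, §2, p. 121] -/
theorem _root_.Literature.Geometry.Lorentzian.PseudoRiemannianMetric.sigma2WeylSchouten_eq
    [CompleteSpace E] [Fact (1 ≤ n)] (hn : 2 ≤ n) (hE : finrank ℝ E = 4) {x : M}
    (hpos : ∀ v : TangentSpace I x, v ≠ 0 → 0 < g.val x v v) :
    g.sigma2WeylSchouten x = -(1 / 2) * g.tracelessRicciNormSq x + g.scalarCurvature x ^ 2 / 24 := by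
  obtain ⟨b, hb⟩ := g.exists_basis_isOrthonormalFrame (x := x) hpos hE
  rw [g.sigma2WeylSchouten_eq_sigma2WeylSchoutenFrame hn hE hb,
    g.sigma2WeylSchoutenFrame_eq_of_isOrthonormalFrame hn hE hb,
    g.tracelessRicciNormSq_eq_tracelessRicciNormSqFrame_four hE hb]

/-- **Pointwise (1.10)/(2.1) gives weak pinching in every orthonormal frame** (Chang–Gursky–Yang
2003, p. 108 and §2, p. 121, "rearranging terms"): `¼|W|²(x) < σ₂(A)(x)` implies
`Σ W² + 2 Σ E² < S(x)²/6` in every `g_x`-orthonormal `4`-frame.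
[cite: ChangGurskyYang2003, §2, p. 121] -/
theorem _root_.Literature.Geometry.Lorentzian.PseudoRiemannianMetric.IsOrthonormalFrame.weakPinching_of_sigma2WeylSchouten_gt
    [CompleteSpace E] [Fact (1 ≤ n)] (hn : 2 ≤ n) (hE : finrank ℝ E = 4) {x : M} {e : Fin 4 → TangentSpace I x}
    (he : g.IsOrthonormalFrame x e) (h : 1 / 4 * g.weylNormSq x < g.sigma2WeylSchouten x) :
    g.weylNormSqFrame x e + 2 * g.tracelessRicciNormSqFrame x e < g.scalarCurvature x ^ 2 / 6 := by
  rw [g.weylNormSq_eq_weylNormSqFrame_four hE he,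
    g.sigma2WeylSchouten_eq_sigma2WeylSchoutenFrame hn hE he] at h
  exact he.weakPinching_of_sigma2_sub_pos g hn hE h

/-- **"Note that this implies in particular that `R ≠ 0`"** (Chang–Gursky–Yang 2003, p. 108, the
pointwise part of "this implies in particular that `R > 0`"): where `g_x` is positive definite,
`¼|W|²(x) < σ₂(A)(x)` forces `S(x) ≠ 0` (as `|W|² + 2|E|² < S²/6` with a non-negative left-hand
side). [cite: ChangGurskyYang2003, p. 108] -/
theorem _root_.Literature.Geometry.Lorentzian.PseudoRiemannianMetric.scalarCurvature_ne_zero_of_sigma2WeylSchouten_gt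
    [CompleteSpace E] [Fact (1 ≤ n)] (hn : 2 ≤ n) (hE : finrank ℝ E = 4) {x : M}
    (hpos : ∀ v : TangentSpace I x, v ≠ 0 → 0 < g.val x v v)
    (h : 1 / 4 * g.weylNormSq x < g.sigma2WeylSchouten x) : g.scalarCurvature x ≠ 0 := by
  obtain ⟨b, hb⟩ := g.exists_basis_isOrthonormalFrame (x := x) hpos hE
  exact scal_ne_zero_of_weakPinching (g.weylNormSqFrame_nonneg x b)
    (g.tracelessRicciNormSqFrame_nonneg x b) (hb.weakPinching_of_sigma2WeylSchouten_gt g hn hE h)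

/-- **Pointwise (2.1) gives `WP(x) < 1/6`** (Chang–Gursky–Yang 2003, p. 108 and §2, p. 121:
"Rearranging terms, this implies `(|W|² + 2|E|²)/R² < 1/6`"), at every point where `g_x` is
positive definite, for a `C²` metric on a `4`-dimensional model.
[cite: ChangGurskyYang2003, §2, p. 121] -/
theorem _root_.Literature.Geometry.Lorentzian.PseudoRiemannianMetric.weakPinching_lt_of_sigma2WeylSchouten_gt
    [CompleteSpace E] [Fact (1 ≤ n)] (hn : 2 ≤ n) (hE : finrank ℝ E = 4) {x : M}
    (hpos : ∀ v : TangentSpace I x, v ≠ 0 → 0 < g.val x v v)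
    (h : 1 / 4 * g.weylNormSq x < g.sigma2WeylSchouten x) : g.weakPinching x < 1 / 6 :=
  (g.weakPinching_lt_iff hE hpos (g.scalarCurvature_ne_zero_of_sigma2WeylSchouten_gt hn hE hpos h)).2
    fun _ he ↦ he.weakPinching_of_sigma2WeylSchouten_gt g hn hE h

/-- **The integral `∫_M σ₂(A_g) dV_g`** of Chang–Gursky–Yang 2003, (1.1)–(1.2) and Thm. 1.4 (ii)
(there: "the conformal invariance of the Weyl tensor implies that the quantity `∫σ₂(A) dvol` is
conformally invariant as well"), as a real number: the Bochner integral of `σ₂(A_g)`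
(`sigma2WeylSchouten`) against the Riemannian measure
`dV_g = riemannianMeasure (g.toContMDiffRiemannianMetric hg)` of `Volume.lean`, for the Borel
σ-algebra `borel M` — built exactly as the Weyl energy `weylEnergy` of `WeylEnergy.lean` (same
measure, no measurable-space instance needed, any `[BorelSpace M]` instance agrees:
`sigma2WeylSchoutenIntegral_eq`); junk value `0` for a non-Riemannian `g` (and, by the Bochner
convention, if `σ₂(A_g)` were not integrable). [cite: ChangGurskyYang2003, §1, (1.1)–(1.2)] -/
def _root_.Literature.Geometry.Lorentzian.PseudoRiemannianMetric.sigma2WeylSchoutenIntegral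
    [T2Space M] : ℝ :=
  haveI : LocallyCompactSpace M := Manifold.locallyCompact_of_finiteDimensional I
  letI : MeasurableSpace M := borel M
  haveI : BorelSpace M := ⟨rfl⟩
  open scoped Classical in
  if hg : g.IsRiemannian then
    ∫ x, g.sigma2WeylSchouten x ∂(riemannianMeasure (g.toContMDiffRiemannianMetric hg))
  else 0

/-- For a non-Riemannian `g` the integral `∫σ₂(A) dV` is the junk value `0`. [folklore] -/
theorem _root_.Literature.Geometry.Lorentzian.PseudoRiemannianMetric.sigma2WeylSchoutenIntegral_of_not_isRiemannian
    [T2Space M] (hg : ¬ g.IsRiemannian) : g.sigma2WeylSchoutenIntegral = 0 := by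
  unfold sigma2WeylSchoutenIntegral
  simp [hg]

/-- **Unfolding of `∫σ₂(A) dV`**: for a Riemannian `g`, and with respect to any Borel measurable
structure on `M` (and any `T₃` witness),
`g.sigma2WeylSchoutenIntegral = ∫ σ₂(A_g) d(riemannianMeasure g)`.
[cite: ChangGurskyYang2003, §1, (1.1)–(1.2)] -/
theorem _root_.Literature.Geometry.Lorentzian.PseudoRiemannianMetric.sigma2WeylSchoutenIntegral_eq
    [T2Space M] [T3Space M] [MeasurableSpace M] [BorelSpace M] (hg : g.IsRiemannian) :
    g.sigma2WeylSchoutenIntegral =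
      ∫ x, g.sigma2WeylSchouten x ∂(riemannianMeasure (g.toContMDiffRiemannianMetric hg)) := by
  have hm : ‹MeasurableSpace M› = borel M := BorelSpace.measurable_eq
  subst hm
  unfold sigma2WeylSchoutenIntegral
  rw [dif_pos hg]

end Sigma2

/-! ### "This implies in particular that `R > 0`": sign of the scalar curvature in a class with `Y > 0` -/

section ScalarCurvatureSign

open MeasureTheory
open Literature.Geometry.Lorentzian (PseudoRiemannianMetric riemannianMeasure)
open Literature.Geometry.Lorentzian.PseudoRiemannianMetric

variable {E : Type*} [NormedAddCommGroup E] [NormedSpace ℝ E] {H : Type*} [TopologicalSpace H]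
  {I : ModelWithCorners ℝ E H} {M : Type*} [TopologicalSpace M] [ChartedSpace H M]
  [IsManifold I ∞ M]

/-- **A conformal class with `Y(M,[g]) > 0` has positive total scalar curvature for each of its
metrics**: if `Y(M,[g]) > 0` then `∫_M R_g dV_g > 0` (the index set of the infimum contains the
Yamabe quotient of `g` itself and is bounded below — otherwise the real infimum would be the junk
value `0` —, so `0 < Y ≤ Q(g) = (∫R_g dV_g)/Vol^{(m-2)/m}` with a non-negative denominator).
(Lee–Parker 1987, (1.5); Chang–Gursky–Yang 2003, Remark 1.) [cite: LeeParker1987, §1, (1.5)] -/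
theorem _root_.Literature.Geometry.Lorentzian.PseudoRiemannianMetric.integral_scalarCurvature_pos_of_yamabeConstant_pos
    [FiniteDimensional ℝ E] [T3Space M] [MeasurableSpace M] [BorelSpace M] {n : ℕ∞ω}
    (g : PseudoRiemannianMetric I n E (TangentSpace I : M → Type _)) [g.HasLeviCivita]
    (hg : g.IsRiemannian) (hY : 0 < yamabeConstant (g.toContMDiffRiemannianMetric hg)) :
    0 < ∫ x, g.scalarCurvature x ∂(riemannianMeasure (g.toContMDiffRiemannianMetric hg)) := by
  haveI : (ofRiemannian (g.toContMDiffRiemannianMetric hg)).HasLeviCivita := ‹g.HasLeviCivita›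
  have hbdd : BddBelow (yamabeQuotients (g.toContMDiffRiemannianMetric hg)) := by
    by_contra h
    rw [yamabeConstant, Real.sInf_of_not_bddBelow h] at hY
    exact lt_irrefl 0 hY
  have hQ : 0 < yamabeQuotient (g.toContMDiffRiemannianMetric hg) :=
    hY.trans_le (yamabeConstant_le hbdd _ (IsConformalTo.refl _))
  rw [yamabeQuotient] at hQ
  have hden : 0 ≤ (riemannianMeasure (g.toContMDiffRiemannianMetric hg) Set.univ).toReal ^
      (((finrank ℝ E : ℝ) - 2) / finrank ℝ E) := Real.rpow_nonneg ENNReal.toReal_nonneg _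
  rcases div_pos_iff.1 hQ with ⟨hnum, _⟩ | ⟨_, hlt⟩
  · exact hnum
  · exact absurd hlt (not_lt.2 hden)

/-- **"Note that this implies in particular that `R > 0`"** (Chang–Gursky–Yang 2003, p. 108): on a
connected manifold, a `C^∞` Riemannian metric `g` whose scalar curvature vanishes nowhere and
whose conformal class has `Y(M,[g]) > 0` has everywhere positive scalar curvature — `R_g` is
continuous (`contMDiff_scalarCurvature`) and nowhere zero, hence of one sign (intermediate value
theorem on the preconnected `M`), and not everywhere negative since `∫R_g dV_g > 0`
(`integral_scalarCurvature_pos_of_yamabeConstant_pos`). This is the step of the proof of Thm. A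
where hypothesis (i) `Y > 0` enters. [cite: ChangGurskyYang2003, p. 108] -/
theorem _root_.Literature.Geometry.Lorentzian.PseudoRiemannianMetric.scalarCurvature_pos_of_yamabeConstant_pos
    [FiniteDimensional ℝ E] [CompleteSpace E] [T3Space M] [MeasurableSpace M] [BorelSpace M]
    [PreconnectedSpace M]
    (g : PseudoRiemannianMetric I ∞ E (TangentSpace I : M → Type _)) [g.HasLeviCivita]
    (hg : g.IsRiemannian) (hY : 0 < yamabeConstant (g.toContMDiffRiemannianMetric hg))
    (hne : ∀ x, g.scalarCurvature x ≠ 0) (x : M) : 0 < g.scalarCurvature x := by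
  have hT := g.integral_scalarCurvature_pos_of_yamabeConstant_pos hg hY
  -- `R` is positive somewhere
  obtain ⟨x₁, hx₁⟩ : ∃ x₁, 0 < g.scalarCurvature x₁ := by
    by_contra h
    push Not at h
    exact absurd (integral_nonpos h) (not_le.2 hT)
  -- and, being continuous and nowhere zero on a preconnected space, positive everywhere
  have hcont : Continuous g.scalarCurvature := (g.contMDiff_scalarCurvature).continuous
  by_contra hx
  push Not at hx
  obtain ⟨z, hz⟩ : (0 : ℝ) ∈ Set.range g.scalarCurvature :=
    intermediate_value_univ x x₁ hcont ⟨lt_of_le_of_ne hx (hne x) |>.le, hx₁.le⟩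
  exact hne z hz

end ScalarCurvatureSign

/-! ### §2 verbatim: Theorem A from Thm. 1.4, Chern–Gauss–Bonnet, `Y > 0` and Margerin's theorem -/

section ReductionPrinted

open MeasureTheory
open Literature.Geometry.Lorentzian (PseudoRiemannianMetric riemannianMeasure)
open Literature.Geometry.Lorentzian.PseudoRiemannianMetric
open Literature.Topology.FourManifolds

/-- **Chang–Gursky–Yang 2003, §2 (p. 121) line by line: Theorem A (vended special case
`changGurskyYang_sphere_four`) from its four published inputs, each a hypothesis stated verbatim in
the tree's vocabulary** (refining `changGurskyYang_sphere_four_of_margerin_of_pointwisePinching`,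
whose hypothesis `hPointwise` bundled the last three):

* `hMargerin` — MARGERIN'S WEAK-PINCHING SPHERE THEOREM (Margerin 1998, Thm. 1, p. 21, with the
  weak pinching `WP = |W + ½ z ⊙ g|²/scal²` of Part I, p. 25 and Prop. 4; quoted by
  Chang–Gursky–Yang 2003, p. 106: "if `R > 0` and `WP < 1/6`, then `M⁴` is diffeomorphic to either
  `S⁴` or `ℝP⁴`", `WP = (|W|² + 2|E|²)/R²` by (0.2), here the function `weakPinching`): a closed
  connected smooth `4`-manifold carrying a `C^∞` Riemannian metric with `R > 0` and `WP < 1/6`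
  everywhere is diffeomorphic to the standard `S⁴` or is a standard `ℝP⁴`
  (`IsRealProjectiveSpace 4 M`; Margerin: "the standard `ℤ₂`-quotient" in the non-orientable case).
* `hYamabe` — A CLASS CONTAINING A METRIC OF POSITIVE SCALAR CURVATURE HAS `Y > 0` (Aubin 1982,
  Ch. 6, §6.5, proof of the Theorem, (α): "the functional `J'` corresponding to `g'` [a metric with
  `R' > 0`] satisfies `J'(ψ) ≥ inf(4(n-1)/(n-2), R') (∫|∇ψ|² + ∫ψ²)(∫ψ^N)^{-2/N}` … by the Sobolev
  imbedding theorem `J'(ψ) ≥ Const > 0` … thus `μ' > 0`", with `μ = Y(M,[g])` by §6.3, eq. (1),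
  §6.4 (`J(φ) = Q(φ^{4/(n-2)} g)`, `dV' = φ^N dV`) and Prop. 6.4; the metric form
  `Y(M,[g]) = inf_{g̃ ∈ [g]} Vol(g̃)^{-1/2} ∫R_{g̃}` is Lee–Parker 1987, (1.5) = Chang–Gursky–Yang
  2003, Remark 1, here `yamabeConstant` of `YamabeConstant.lean`): on a closed connected (in particular non-empty:
  on the empty manifold the real infimum is the junk value `0`) smooth `4`-manifold, `scal_g > 0`
  everywhere implies `Y(M,[g]) > 0` — PROVED in this tree, `yamabeConstant_pos_of_scalarCurvature_pos`
  (`YamabePositivity.lean`), and discharged in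
  `changGurskyYang_sphere_four_of_margerin_of_chernGaussBonnet_of_thm14` below. This is how hypothesis (i) of Thm. A is met in
  the vended special case.
* `hCGB` — THE CHERN–GAUSS–BONNET FORMULA WITH `χ(M) ≥ 2` (Chang–Gursky–Yang 2003, (0.4)/(1.1):
  `8π² χ(M⁴) = ¼∫|W|² dvol + ∫σ₂(A) dvol`; for a closed simply connected `4`-manifold
  `χ(M) = 2 + b₂(M)` is a natural number `≥ 2` — orientability, `b₁ = b₃ = 0` by Hurewicz and
  Poincaré duality, Hatcher 2002, Thm. 3.30): for every `C^∞` Riemannian metric on a closed simply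
  connected smooth `4`-manifold there is a natural number `χ ≥ 2` with
  `8π² χ = ¼ (∫|W|² dV).toReal + ∫σ₂(A) dV` (`weylEnergy`, finite by `weylEnergy_lt_top`;
  `sigma2WeylSchoutenIntegral`). This is "(0.3) is equivalent to (1.2)" (§2, line 2) together
  with `32π² ≤ 16π² χ(M)`.
* `hThm14` — THEOREM 1.4 WITH `α = 1` (Chang–Gursky–Yang 2003, pp. 112–113, from [CGY1]): for a
  smooth closed Riemannian `4`-manifold `(M, g₀)` with (i) `Y(M,[g₀]) > 0` and (ii)
  `∫σ₂(A_{g₀}) dV₀ - ¼∫|W_{g₀}|² dV₀ > 0` there is a conformal metric `g = e^{2w} g₀`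
  (`IsConformalTo`, `YamabeConstant.lean`) with `σ₂(A_g) - ¼|W_g|² > 0` pointwise
  (`sigma2WeylSchouten`, `weylNormSq`).

Proof, as printed (§2 and p. 108): `Y(M,[g]) > 0` (`hYamabe`); `∫|W|² < 32π² ≤ 16π²χ` turns
`hCGB` into (1.2); `hThm14` gives a conformal `g'` with `σ₂(A) - ¼|W|² > 0`; "rearranging terms"
(`weakPinching_lt_of_sigma2WeylSchouten_gt`: (0.2) and `σ₂(A) = -½|E|² + R²/24`) gives
`WP < 1/6` and `R ≠ 0` pointwise, and "this implies in particular that `R > 0`"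
(`scalarCurvature_pos_of_yamabeConstant_pos`: `Y(M,[g']) = Y(M,[g]) > 0` by conformal invariance,
`yamabeConstant_eq_of_isConformalTo`, continuity of `R` and connectedness); Margerin's theorem
gives `S⁴` or `ℝP⁴`, and `π₁(ℝP⁴) ≠ 1` (`IsRealProjectiveSpace.not_simplyConnectedSpace`) leaves
`S⁴`. None of the four hypotheses is a named fact of the tree; they are the exact remaining proof
debt of `changGurskyYang_sphere_four` (Ricci flow; Sobolev embedding on closed manifolds and the
conformal transformation laws; Chern–Weil theory and Poincaré duality; the fully nonlinear PDE of
[CGY1]). [cite: ChangGurskyYang2003, §2, p. 121] [cite: ChangGurskyYang2003, Thm. 1.4]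
[cite: Margerin1998, Thm. 1] [cite: Aubin1982, Ch. 6, §6.5] [cite: Hatcher2002, Thm. 3.30] -/
theorem changGurskyYang_sphere_four_of_margerin_of_yamabe_of_chernGaussBonnet_of_thm14
    (hMargerin : ∀ (M : Type) [TopologicalSpace M] [T2Space M] [SecondCountableTopology M]
      [ChartedSpace (EuclideanSpace ℝ (Fin 4)) M] [IsManifold (𝓡 4) ∞ M] [CompactSpace M]
      [ConnectedSpace M]
      (g : PseudoRiemannianMetric (𝓡 4) ∞ (EuclideanSpace ℝ (Fin 4)) (TangentSpace (𝓡 4) : M → Type _))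
      [g.HasLeviCivita], g.IsRiemannian → (∀ x, 0 < g.scalarCurvature x) →
      (∀ x, g.weakPinching x < 1 / 6) →
      Nonempty (M ≃ₘ⟮𝓡 4, 𝓡 4⟯ Metric.sphere (0 : EuclideanSpace ℝ (Fin 5)) 1) ∨
        IsRealProjectiveSpace 4 M)
    (hYamabe : ∀ (M : Type) [TopologicalSpace M] [T2Space M] [SecondCountableTopology M]
      [ChartedSpace (EuclideanSpace ℝ (Fin 4)) M] [IsManifold (𝓡 4) ∞ M] [CompactSpace M]
      [ConnectedSpace M] [MeasurableSpace M] [BorelSpace M]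
      (g : PseudoRiemannianMetric (𝓡 4) ∞ (EuclideanSpace ℝ (Fin 4)) (TangentSpace (𝓡 4) : M → Type _))
      [g.HasLeviCivita] (hg : g.IsRiemannian), (∀ x, 0 < g.scalarCurvature x) →
      0 < yamabeConstant (g.toContMDiffRiemannianMetric hg))
    (hCGB : ∀ (M : Type) [TopologicalSpace M] [T2Space M] [SecondCountableTopology M]
      [ChartedSpace (EuclideanSpace ℝ (Fin 4)) M] [IsManifold (𝓡 4) ∞ M] [CompactSpace M]
      [SimplyConnectedSpace M]
      (g : PseudoRiemannianMetric (𝓡 4) ∞ (EuclideanSpace ℝ (Fin 4)) (TangentSpace (𝓡 4) : M → Type _))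
      [g.HasLeviCivita], g.IsRiemannian →
      ∃ χ : ℕ, 2 ≤ χ ∧
        8 * Real.pi ^ 2 * χ = 1 / 4 * g.weylEnergy.toReal + g.sigma2WeylSchoutenIntegral)
    (hThm14 : ∀ (M : Type) [TopologicalSpace M] [T2Space M] [SecondCountableTopology M]
      [ChartedSpace (EuclideanSpace ℝ (Fin 4)) M] [IsManifold (𝓡 4) ∞ M] [CompactSpace M]
      [MeasurableSpace M] [BorelSpace M]
      (g₀ : PseudoRiemannianMetric (𝓡 4) ∞ (EuclideanSpace ℝ (Fin 4)) (TangentSpace (𝓡 4) : M → Type _))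
      [g₀.HasLeviCivita] (hg₀ : g₀.IsRiemannian),
      0 < yamabeConstant (g₀.toContMDiffRiemannianMetric hg₀) →
      1 / 4 * g₀.weylEnergy.toReal < g₀.sigma2WeylSchoutenIntegral →
      ∃ (g : PseudoRiemannianMetric (𝓡 4) ∞ (EuclideanSpace ℝ (Fin 4)) (TangentSpace (𝓡 4) : M → Type _))
        (_ : g.HasLeviCivita) (hg : g.IsRiemannian),
        IsConformalTo (g.toContMDiffRiemannianMetric hg) (g₀.toContMDiffRiemannianMetric hg₀) ∧
        ∀ x, 1 / 4 * g.weylNormSq x < g.sigma2WeylSchouten x) :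
    changGurskyYang_sphere_four := by
  intro M _ _ _ _ _ _ _ hg
  obtain ⟨g, _, hgR, hscal, hW⟩ := hg
  letI : MeasurableSpace M := borel M
  haveI : BorelSpace M := ⟨rfl⟩
  have hE : finrank ℝ (EuclideanSpace ℝ (Fin 4)) = 4 := finrank_euclideanSpace_fin
  -- (i): `Y(M,[g]) > 0` since `scal_g > 0`
  have hY : 0 < yamabeConstant (g.toContMDiffRiemannianMetric hgR) := hYamabe M g hgR hscal
  -- (ii): (0.3) ⇒ (1.2) by Chern–Gauss–Bonnet and `χ(M) ≥ 2`
  have hWr : g.weylEnergy.toReal < 32 * Real.pi ^ 2 :=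
    (ENNReal.lt_ofReal_iff_toReal_lt (g.weylEnergy_lt_top hgR).ne).1 hW
  have h12 : 1 / 4 * g.weylEnergy.toReal < g.sigma2WeylSchoutenIntegral := by
    obtain ⟨χ, hχ, hCGBχ⟩ := hCGB M g hgR
    have hχ' : (2 : ℝ) ≤ χ := by exact_mod_cast hχ
    have hπ : 0 < Real.pi ^ 2 := by positivity
    nlinarith
  -- §1, Thm. 1.4 (α = 1): a conformal metric with `σ₂(A) - ¼|W|² > 0` pointwise
  obtain ⟨g', _, hg'R, hconf, hpt⟩ := hThm14 M g hgR hY h12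
  have hpos' : ∀ (x : M) (v : TangentSpace (𝓡 4) x), v ≠ 0 → 0 < g'.val x v v :=
    fun x v hv ↦ hg'R x v hv
  -- "Rearranging terms": `WP < 1/6` and `R ≠ 0` pointwise; "in particular `R > 0`" by `Y > 0`
  have hne : ∀ x, g'.scalarCurvature x ≠ 0 := fun x ↦
    g'.scalarCurvature_ne_zero_of_sigma2WeylSchouten_gt (WithTop.coe_le_coe.mpr le_top) hE
      (hpos' x) (hpt x)
  have hY' : 0 < yamabeConstant (g'.toContMDiffRiemannianMetric hg'R) := by
    rwa [yamabeConstant_eq_of_isConformalTo hconf]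
  have hscal' : ∀ x, 0 < g'.scalarCurvature x :=
    g'.scalarCurvature_pos_of_yamabeConstant_pos hg'R hY' hne
  have hWP : ∀ x, g'.weakPinching x < 1 / 6 := fun x ↦
    g'.weakPinching_lt_of_sigma2WeylSchouten_gt (WithTop.coe_le_coe.mpr le_top) hE (hpos' x) (hpt x)
  -- Margerin: `S⁴` or `ℝP⁴` (`M` is connected, being simply connected); `π₁ = 1` excludes `ℝP⁴`
  rcases hMargerin M g' hg'R hscal' hWP with h | h
  · exact h
  · exact absurd ‹SimplyConnectedSpace M› (h.not_simplyConnectedSpace (by norm_num))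


/-- **Theorem A (vended special case) from its three deep inputs — `hYamabe` discharged.**
Chang–Gursky–Yang 2003, §2 with hypothesis (i) `Y(M⁴,[g]) > 0` of Thm. A supplied, in the
`scal > 0` special case, by the theorem `yamabeConstant_pos_of_scalarCurvature_pos`
(`YamabePositivity.lean`: a conformal class containing a metric of positive scalar curvature on a
closed connected `4`-manifold has positive Yamabe constant — Aubin 1982, Ch. 6, §6.5, proved in
this tree from the conformal transformation laws, Green's identity and the Sobolev inequality on
closed manifolds). The remaining hypotheses are exactly those of
`changGurskyYang_sphere_four_of_margerin_of_yamabe_of_chernGaussBonnet_of_thm14`: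
`hMargerin` (Margerin 1998, Thm. 1), `hCGB` (Chern–Gauss–Bonnet (1.1) with `χ(M) ∈ ℕ`, `χ ≥ 2`
for closed simply connected `M`, Hatcher 2002, Thm. 3.30) and `hThm14` (Chang–Gursky–Yang 2003,
Thm. 1.4 with `α = 1`) — Ricci flow, Chern–Weil theory with Poincaré duality, and the fully
nonlinear PDE of [CGY1]: the exact remaining proof debt of `changGurskyYang_sphere_four`.
[cite: ChangGurskyYang2003, §2, p. 121] [cite: ChangGurskyYang2003, Thm. 1.4]
[cite: Margerin1998, Thm. 1] [cite: Aubin1982, Ch. 6, §6.5] [cite: Hatcher2002, Thm. 3.30] -/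
theorem changGurskyYang_sphere_four_of_margerin_of_chernGaussBonnet_of_thm14
    (hMargerin : ∀ (M : Type) [TopologicalSpace M] [T2Space M] [SecondCountableTopology M]
      [ChartedSpace (EuclideanSpace ℝ (Fin 4)) M] [IsManifold (𝓡 4) ∞ M] [CompactSpace M]
      [ConnectedSpace M]
      (g : PseudoRiemannianMetric (𝓡 4) ∞ (EuclideanSpace ℝ (Fin 4)) (TangentSpace (𝓡 4) : M → Type _))
      [g.HasLeviCivita], g.IsRiemannian → (∀ x, 0 < g.scalarCurvature x) →
      (∀ x, g.weakPinching x < 1 / 6) →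
      Nonempty (M ≃ₘ⟮𝓡 4, 𝓡 4⟯ Metric.sphere (0 : EuclideanSpace ℝ (Fin 5)) 1) ∨
        IsRealProjectiveSpace 4 M)
    (hCGB : ∀ (M : Type) [TopologicalSpace M] [T2Space M] [SecondCountableTopology M]
      [ChartedSpace (EuclideanSpace ℝ (Fin 4)) M] [IsManifold (𝓡 4) ∞ M] [CompactSpace M]
      [SimplyConnectedSpace M]
      (g : PseudoRiemannianMetric (𝓡 4) ∞ (EuclideanSpace ℝ (Fin 4)) (TangentSpace (𝓡 4) : M → Type _))
      [g.HasLeviCivita], g.IsRiemannian →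
      ∃ χ : ℕ, 2 ≤ χ ∧
        8 * Real.pi ^ 2 * χ = 1 / 4 * g.weylEnergy.toReal + g.sigma2WeylSchoutenIntegral)
    (hThm14 : ∀ (M : Type) [TopologicalSpace M] [T2Space M] [SecondCountableTopology M]
      [ChartedSpace (EuclideanSpace ℝ (Fin 4)) M] [IsManifold (𝓡 4) ∞ M] [CompactSpace M]
      [MeasurableSpace M] [BorelSpace M]
      (g₀ : PseudoRiemannianMetric (𝓡 4) ∞ (EuclideanSpace ℝ (Fin 4)) (TangentSpace (𝓡 4) : M → Type _))
      [g₀.HasLeviCivita] (hg₀ : g₀.IsRiemannian),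
      0 < yamabeConstant (g₀.toContMDiffRiemannianMetric hg₀) →
      1 / 4 * g₀.weylEnergy.toReal < g₀.sigma2WeylSchoutenIntegral →
      ∃ (g : PseudoRiemannianMetric (𝓡 4) ∞ (EuclideanSpace ℝ (Fin 4)) (TangentSpace (𝓡 4) : M → Type _))
        (_ : g.HasLeviCivita) (hg : g.IsRiemannian),
        IsConformalTo (g.toContMDiffRiemannianMetric hg) (g₀.toContMDiffRiemannianMetric hg₀) ∧
        ∀ x, 1 / 4 * g.weylNormSq x < g.sigma2WeylSchouten x) :
    changGurskyYang_sphere_four :=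
  changGurskyYang_sphere_four_of_margerin_of_yamabe_of_chernGaussBonnet_of_thm14 hMargerin
    (fun _ _ _ _ _ _ _ _ _ _ g _ hg hscal ↦ yamabeConstant_pos_of_scalarCurvature_pos g hg hscal)
    hCGB hThm14

end ReductionPrinted

end Literature.Geometry.Riemannian

end
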